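import Literature.NumberTheory.LFunctions.RobinLiThetaCriterionRH
import Literature.NumberTheory.LFunctions.NicolasJExplicit
import Literature.NumberTheory.LFunctions.TrivialZerosSimple
import Literature.NumberTheory.LFunctions.RHConditionalFactsVonKochProofs
import Literature.NumberTheory.LFunctions.LogIntegralProofs
import Mathlib.Analysis.Asymptotics.AsymptoticEquivalent
import Mathlib.Analysis.SpecialFunctions.Pow.Asymptotics
import HarnessLib

/-!
# RH-EQUIVALENT — Nicolas 2017, Thm. 1.1 (1.6)–(1.7) PROVED under RH: `2 − λ ≤ lim inf ≤ lim sup A(x) log²x/√x ≤ 2 + λ`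

RH-CONDITIONAL (`RH ⟹` (1.6), (1.7)) and RH-EQUIVALENT (`RH ⟺ (1.6)`, `RH ⟺ (1.7)`, Nicolas 2017,
Cor. 1.1, now theorems of the tree); nothing here bears on the truth of RH — implications from RH and
two equivalences are proved, neither side is asserted. Literature-typing tranche 1 (Broughan,
*Equivalents of the Riemann Hypothesis* vol. 3 (2023), Ch. 1 "Nicolas' `π(x) < li(θ(x))` equivalence";
the arithmetic opening chapter of that volume, swept with vol. 1).

`A(x) = li(θ(x)) − π(x)` is the tree's `liThetaSubPi`; `λ = ∑_ρ 1/|ρ|² = 2 + γ − log π − 2 log 2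
= 0.0461914…` (Nicolas 2017, (1.5)) is the tree's `nicolasBeta` (`hasSum_zeroOrder_div_norm_sq_of_RH`).
The named fact `Literature.NumberTheory.LFunctions.Nicolas2017_thm1_1` (`NicolasLiThetaCriterion.lean`)
packages the five clauses (1.6)–(1.10) of Nicolas's Thm. 1.1. This file PROVES the two asymptotic
clauses:

* `Nicolas2017_thm1_1_limsup` — under RH, `∀ ε > 0`, eventually `A(x) log²x/√x ≤ 2 + λ + ε` ((1.6));
* `Nicolas2017_thm1_1_liminf` — under RH, `∀ ε > 0`, eventually `A(x) log²x/√x ≥ 2 − λ − ε` ((1.7));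
* `riemannHypothesis_iff_liThetaSubPi_limsup_le`, `riemannHypothesis_iff_liThetaSubPi_liminf_ge` —
  Cor. 1.1 for (1.6) and for (1.7): **each is EQUIVALENT to RH** (the converse by Robin 1984, Lemma 2,
  `A(x) = Ω±(x^b)`, `b > 1/2`, off RH — the tree's PROVED `Robin1984Toulouse_lemma2_holds`);
* `Nicolas2017_thm1_1_of_explicit` — the named fact now FOLLOWS from its three explicit-range clauses
  (1.8)–(1.10) alone (those rest on Nicolas's computation of `A(p)` at all primes `p < 10⁸`, §3.5, and on
  the Platt–Trudgian range `θ(x) < x`, `x ≤ 1.39·10¹⁷`, Prop. 3.6 (i) — computational, not proved here);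
* (§9–§11, explicit) `LiThetaLimsup.abs_robinD_le_explicit` — under RH, `|D(x)| ≤ 0.0474 √x/log²x +
  4.3 √x/log³x + 2500` (`x ≥ 2`); `LiThetaLimsup.liThetaSubPi_pos_of_exp_le` — under RH with Schoenfeld's
  explicit bounds (the named facts `Schoenfeld1976_theta`, `schoenfeld_explicit`), `A(x) > 0` for every
  `x ≥ e³⁶`; hence **clause (1.8)** `Nicolas2017_thm1_1_pos_of` and **`RH ⟺ A(x) > 0 ∀ x ≥ 11`**
  (`riemannHypothesis_iff_liThetaSubPi_pos_of_schoenfeld`, standard axioms over the three named facts;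
  feeding the tree's certified-zeros theorems `Schoenfeld1976_theta_holds` (`SchoenfeldThetaLarge.lean`)
  and `schoenfeld_explicit_holds` (`RHConditionalFactsSchoenfeldProofs.lean`) leaves the single RH-free
  computational input `PlattTrudgian2016_theta_lt` — not done in this file, which keeps standard axioms).
  The range `11 ≤ x ≤ 1.39·10¹⁷` is Nicolas's
  Prop. 3.6 (i) (the tree's `Nicolas2017_prop36_i`); above it our explicit margin is a factor `> 5`
  (Nicolas's own constants give the analytic bound from `9·10⁶`, Prop. 3.3 — not reproduced).

## The printed proof and the road taken

Nicolas (§1.2, §3) writes `A = A₁ + A₂`, `A₁ = li(ψ(x)) − Π(x) = ∑_ρ x^ρ/(ρ² log²x) + J(x)` (Prop. 3.1,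
from Landau's explicit formula (2.24) for `Π̃` and one partial integration, Lemma 3.2, with
`∑ 1/|γ|³ ≤ 1/300`, Lemma 3.1) and `A₂ = ∑_{k≥2} B(x^{1/k})/k + U(x)`, `B(y) = π(y) − θ(y)/log y`
(Prop. 3.2, Lemmas 3.3–3.4), whence Cor. 3.3: `(2 − λ + (7.993+o(1))/log x) √x/log²x ≤ A(x) ≤
(2 + λ + (8.007+o(1))/log x) √x/log²x`, which contains (1.6)–(1.7).

DEVIATION (recorded): Landau's formula (2.24) for `Π̃(x)` is not in the tree. We run the SAME
bookkeeping through Robin's `D(x) = (ψ(x) − x)/log x − (Π(x) − li x)` (Robin 1984, §4 (13); the tree's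
`RobinLiTheta.robinD`, with `A = D + li 2 + P − gap`, `LiThetaRH.liThetaSubPi_eq_posPart`) and the tree's
explicit formula for `ψ₁` (`psiOne_eq_explicit`, MV (13.7), absolutely convergent zero sum
`Z(t) = ∑_ρ m(ρ) t^{ρ+1}/(ρ(ρ+1))`, remainder `E` evaluated over the trivial zeros):
`F = D + R·w` (`R = ψ₁ − t²/2`, `w = 1/(t log² t)`) has right derivative `R w'`, so
`D(x) = F(x₀) + Re[Z(x)w(x) − ∫_{x₀}^x Z w'] + log 2π·(x w(x) − ∫_{x₀}^x t w') + (∫_{x₀}^x Re E·w' − Re E(x)w(x))`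
(`LiThetaLimsup.robinD_eq_brackets`); the zero bracket is summed termwise (dominated convergence) and
each zero is integrated by parts TWICE and the boundary terms are COMBINED before taking norms
(`1/(ρ(ρ+1)) + 1/(ρ²(ρ+1)) = 1/ρ²`):
`zeroTerm_ρ(x) w(x) − ∫_{x₀}^x zeroTerm_ρ w' = m(ρ)[x^ρ/(ρ² log²x) + 2x^ρ/(ρ²(ρ+1)log³x) − x₀^ρ u(x₀)/(ρ²(ρ+1))
 − (1/(ρ²(ρ+1)))∫_{x₀}^x t^ρ u'(t) dt]`, `u(t) = (log t + 2)/log³ t` (`LiThetaLimsup.zeroPiece_eq`). This is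
Nicolas's `∑_ρ x^ρ/(ρ² log² x)` main term exactly, with the lower-order terms weighted by
`λ₃ = ∑ m(ρ)/|ρ|³` (his Lemma 3.1/3.2 in our normalisation). Hence under RH
`|D(x)| ≤ λ √x/log²x + λ₃(2√x/log³x + ∫_{x₀}^x √t|u'|) + dConst x₀` (`LiThetaLimsup.abs_robinD_le_sharp`,
every constant explicit in `x₀`), and `|D(x)| ≤ λ √x/log²x + C₁ √x/log³x + C₀` (`exists_abs_robinD_le_of_RH`).
The prime-power part is identified exactly: `P(x) = ∑_{2 ≤ k ≤ log x/log 2} B(x^{1/k})/k`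
(`LiThetaLimsup.posPart_eq_sum_nicolasB`, Nicolas's (3.14) without the `li`-linearisation term `U`,
which in Robin's decomposition sits in `gap`), `B(√x)/2 ≤ P(x) ≤ B(√x)/2 + (log x/log 2) x^{1/3}`, and
under RH `B(y) ∼ y/log² y` (von Koch for `π` and `θ`, `li(y) = y/log y + y/log² y + 2Li₃(y) + c`), so
`P(x) log²x/√x → 2` (`LiThetaLimsup.tendsto_posPart_ratio`) — Nicolas's `T₁ = L₁(√x)/2 = 2√x/log²x + …`.
With `0 ≤ gap(x) ≤ 8K² log² x` (tree) the two clauses follow. The explicit clauses (1.8)–(1.10) and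
the constants `7.993/8.007/5.12/25.22` of Cor. 3.1–3.2 are NOT reproduced (they need the finite
computation of §3.5).

## References

* J.-L. Nicolas, *Estimates of `li(θ(x)) − π(x)` and the Riemann Hypothesis*, in: Analytic Number
  Theory, Modular Forms and q-Hypergeometric Series (in honor of K. Alladi), Springer PROMS 221 (2017)
  587–610; HAL hal-02078840 [corpus:paper:url-53b719e08af7, read in full: (1.2)–(1.5) p.1–2, Thm. 1.1,
  Cor. 1.1 p.2, §1.2 plan p.3, Lemma 2.1–2.4, (2.22)–(2.26), Lemmas 3.1–3.4, Props. 3.1–3.6,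
  Cors. 3.1–3.3, §3.6]. [Nicolas2017]
* G. Robin, *Sur la différence `Li(θ(x)) − π(x)`*, Ann. Fac. Sci. Toulouse (5) 6 (1984) 257–268,
  Thm. 1, §4 (13)–(16), Lemma 2. [Robin1984Toulouse]
* H. L. Montgomery, R. C. Vaughan, *Multiplicative Number Theory I*, CUP 2007, (13.7)–(13.8),
  §12.1.1 Exercise 6. [MontgomeryVaughan2007]
* K. Broughan, *Equivalents of the Riemann Hypothesis. Vol. 3*, CUP 2023, Ch. 1 (doi
  10.1017/9781009384780.002; not held). [Broughan2023Further]
-/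

noncomputable section

open Real Filter Set Topology MeasureTheory intervalIntegral
open scoped Chebyshev

namespace Literature.NumberTheory.LFunctions

namespace LiThetaLimsup

open RobinLiTheta LiThetaRH NicolasJExplicit

/-! ### §1. The weights `u(t) = (log t + 2)/log³ t = −t² w'(t)` and `u'` -/

/-- `u(t) = (log t + 2)/log³ t`, so that `t^{ρ+1} w'(t) = −t^{ρ−1} u(t)`. [folklore] -/
def uw (t : ℝ) : ℝ := (Real.log t + 2) / Real.log t ^ 3

/-- `u'(t) = −(2 log t + 6)/(t log⁴ t)`. [folklore] -/
def uwDeriv (t : ℝ) : ℝ := -(2 * Real.log t + 6) / (t * Real.log t ^ 4)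

/-- `u' = uwDeriv` for `t > 1`. [folklore] -/
private theorem hasDerivAt_uw {t : ℝ} (ht : 1 < t) : HasDerivAt uw (uwDeriv t) t := by
  have ht0 : t ≠ 0 := by linarith
  have hlog : Real.log t ≠ 0 := (Real.log_pos ht).ne'
  have h1 : HasDerivAt (fun s : ℝ ↦ Real.log s + 2) (t⁻¹) t := by
    simpa using (Real.hasDerivAt_log ht0).add_const 2
  have h2 : HasDerivAt (fun s : ℝ ↦ Real.log s ^ 3) ((3 : ℕ) * Real.log t ^ (3 - 1) * t⁻¹) t :=
    (Real.hasDerivAt_log ht0).pow 3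
  have h := h1.div h2 (pow_ne_zero _ hlog)
  refine h.congr_deriv ?_
  rw [uwDeriv]
  push_cast
  field_simp
  ring

/-- `u` is continuous on `(1, ∞)`. [folklore] -/
private theorem continuousOn_uw : ContinuousOn uw (Ioi 1) := fun _ ht ↦
  (hasDerivAt_uw ht).continuousAt.continuousWithinAt

/-- `u'` is continuous on `(1, ∞)`. [folklore] -/
private theorem continuousOn_uwDeriv : ContinuousOn uwDeriv (Ioi 1) := by
  have hl : ContinuousOn Real.log (Ioi (1 : ℝ)) :=
    Real.continuousOn_log.mono fun t ht ↦ by simp only [mem_Ioi] at ht; simp; linarith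
  refine ContinuousOn.div ?_ (continuousOn_id.mul (hl.pow 4)) fun t ht ↦ ?_
  · exact ((continuousOn_const.mul hl).add continuousOn_const).neg
  · simp only [mem_Ioi] at ht
    exact mul_ne_zero (by linarith) (pow_ne_zero _ (Real.log_pos ht).ne')

/-- `u(t) ≥ 0` for `t > 1`. [folklore] -/
private theorem uw_nonneg {t : ℝ} (ht : 1 < t) : 0 ≤ uw t := by
  have := Real.log_pos ht
  unfold uw; positivity

/-- `|u'(t)| ≤ (2 + 6/log a)/(t log³ t)` for `t ≥ a > 1`. [folklore] -/
private theorem abs_uwDeriv_le {a t : ℝ} (ha : 1 < a) (hat : a ≤ t) :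
    |uwDeriv t| ≤ (2 + 6 / Real.log a) / (t * Real.log t ^ 3) := by
  have ht : 1 < t := by linarith
  have ht0 : 0 < t := by linarith
  have hla : 0 < Real.log a := Real.log_pos ha
  have hlt : 0 < Real.log t := Real.log_pos ht
  have hlat : Real.log a ≤ Real.log t := Real.log_le_log (by linarith) hat
  rw [uwDeriv, abs_div, abs_neg, abs_of_pos (by positivity : 0 < 2 * Real.log t + 6),
    abs_of_pos (by positivity : 0 < t * Real.log t ^ 4), div_le_div_iff₀ (by positivity) (by positivity)]
  have h6 : 6 / Real.log t ≤ 6 / Real.log a := div_le_div_of_nonneg_left (by norm_num) hla hlat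
  have e : (2 * Real.log t + 6) * (t * Real.log t ^ 3) = (2 + 6 / Real.log t) * (t * Real.log t ^ 4) := by
    field_simp
  rw [e]
  exact mul_le_mul_of_nonneg_right (by linarith) (by positivity)

/-- `t^{ρ+1} w'(t) = −t^{ρ−1} u(t)` (`t > 1`), in `ℂ`. [folklore] -/
private theorem cpow_add_one_mul_wtDeriv {t : ℝ} (ht : 1 < t) (ρ : ℂ) :
    (t : ℂ) ^ (ρ + 1) * (wtDeriv t : ℂ) = -((t : ℂ) ^ (ρ - 1) * (uw t : ℂ)) := by
  have ht0 : (t : ℂ) ≠ 0 := by exact_mod_cast (by linarith : t ≠ 0)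
  have hlog : Real.log t ≠ 0 := (Real.log_pos ht).ne'
  have e1 : (t : ℂ) ^ (ρ + 1) = (t : ℂ) ^ (ρ - 1) * (t : ℂ) ^ 2 := by
    rw [← Complex.cpow_natCast, ← Complex.cpow_add _ _ ht0]
    congr 1; push_cast; ring
  rw [e1, wtDeriv, uw]
  push_cast
  field_simp

/-- `x^{ρ+1} w(x) = x^ρ/log² x` (`x > 1`), in `ℂ`. [folklore] -/
private theorem cpow_add_one_mul_wt {x : ℝ} (hx : 1 < x) (ρ : ℂ) :
    (x : ℂ) ^ (ρ + 1) * (wt x : ℂ) = (x : ℂ) ^ ρ / (Real.log x : ℂ) ^ 2 := by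
  have hx0 : (x : ℂ) ≠ 0 := by exact_mod_cast (by linarith : x ≠ 0)
  have hlog : (Real.log x : ℂ) ≠ 0 := by exact_mod_cast (Real.log_pos hx).ne'
  rw [Complex.cpow_add _ _ hx0, Complex.cpow_one, wt]
  push_cast
  field_simp

/-- **One zero, integration by parts** on `[x₀, x] ⊂ (1, ∞)`: for `ρ ≠ 0`,
`∫_{x₀}^x t^{ρ−1} u(t) dt = (x^ρ u(x) − x₀^ρ u(x₀))/ρ − (1/ρ) ∫_{x₀}^x t^ρ u'(t) dt`. [folklore] -/
private theorem integral_cpow_mul_uw {ρ : ℂ} (hρ : ρ ≠ 0) {x₀ x : ℝ} (hx₀ : 1 < x₀) (hx : x₀ ≤ x) :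
    ∫ t in x₀..x, (t : ℂ) ^ (ρ - 1) * (uw t : ℂ) =
      ((x : ℂ) ^ ρ * (uw x : ℂ) - (x₀ : ℂ) ^ ρ * (uw x₀ : ℂ)) / ρ -
        (1 / ρ) * ∫ t in x₀..x, (t : ℂ) ^ ρ * (uwDeriv t : ℂ) := by
  have hmem : ∀ t ∈ uIcc x₀ x, 1 < t := fun t ht ↦ by
    rw [uIcc_of_le hx] at ht; exact hx₀.trans_le ht.1
  -- `V(t) = t^ρ/ρ`, `V' = t^{ρ−1}`
  have hV : ∀ t ∈ uIcc x₀ x, HasDerivAt (fun s : ℝ ↦ (s : ℂ) ^ ρ / ρ) ((t : ℂ) ^ (ρ - 1)) t := by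
    intro t ht
    have ht0 : t ≠ 0 := by linarith [hmem t ht]
    have h := hasDerivAt_ofReal_cpow_const' ht0 (r := ρ - 1) (by
      intro h; apply hρ; linear_combination h)
    simp only [sub_add_cancel] at h
    exact h
  have hU : ∀ t ∈ uIcc x₀ x, HasDerivAt (fun s : ℝ ↦ (uw s : ℂ)) ((uwDeriv t : ℂ)) t := fun t ht ↦
    (hasDerivAt_uw (hmem t ht)).ofReal_comp
  have hUc : ContinuousOn (fun s : ℝ ↦ (uwDeriv s : ℂ)) (uIcc x₀ x) :=
    (Complex.continuous_ofReal.comp_continuousOn continuousOn_uwDeriv).mono fun t ht ↦ hmem t ht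
  have hVc : ContinuousOn (fun s : ℝ ↦ (s : ℂ) ^ (ρ - 1)) (uIcc x₀ x) := fun t ht ↦
    (ContinuousAt.continuousWithinAt (by
      exact Complex.continuousAt_ofReal_cpow_const _ _ (Or.inr (by linarith [hmem t ht]))))
  have hparts := intervalIntegral.integral_mul_deriv_eq_deriv_mul hU hV
    (hUc.intervalIntegrable) (hVc.intervalIntegrable)
  -- `∫ u · V' = u V|  − ∫ u' V`
  have e1 : ∫ t in x₀..x, (t : ℂ) ^ (ρ - 1) * (uw t : ℂ) = ∫ t in x₀..x, (uw t : ℂ) * (t : ℂ) ^ (ρ - 1) :=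
    intervalIntegral.integral_congr fun t _ ↦ by ring
  have e2 : ∫ t in x₀..x, (uwDeriv t : ℂ) * ((t : ℂ) ^ ρ / ρ) =
      (1 / ρ) * ∫ t in x₀..x, (t : ℂ) ^ ρ * (uwDeriv t : ℂ) := by
    rw [← intervalIntegral.integral_const_mul]
    refine intervalIntegral.integral_congr fun t _ ↦ ?_
    field_simp
  rw [e1, hparts, e2]
  field_simp


/-! ### §2. One zero: the exact piece and its size under RH -/

/-- `u` is non-increasing on `(1, ∞)` (`u = 1/log² + 2/log³`). [folklore] -/
private theorem uw_antitone {s t : ℝ} (hs : 1 < s) (hst : s ≤ t) : uw t ≤ uw s := by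
  have hls : 0 < Real.log s := Real.log_pos hs
  have hlt : Real.log s ≤ Real.log t := Real.log_le_log (by linarith) hst
  have e : ∀ r : ℝ, 0 < Real.log r → uw r = 1 / Real.log r ^ 2 + 2 / Real.log r ^ 3 := by
    intro r hr; rw [uw]; field_simp
  rw [e s hls, e t (hls.trans_le hlt)]
  gcongr

/-- `|w'(t)| = u(t)/t²` (`t > 1`). [folklore] -/
private theorem abs_wtDeriv_eq {t : ℝ} (ht : 1 < t) : |wtDeriv t| = uw t / t ^ 2 := by
  have hl : 0 < Real.log t := Real.log_pos ht
  have ht0 : 0 < t := by linarith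
  rw [wtDeriv, abs_div, abs_neg, abs_of_pos (by positivity : 0 < Real.log t + 2),
    abs_of_pos (by positivity : 0 < t ^ 2 * Real.log t ^ 3), uw]
  field_simp

/-- `|w'(t)| ≤ u(x₀)/x₀²` for `t ≥ x₀ > 1`. [folklore] -/
private theorem abs_wtDeriv_le {x₀ t : ℝ} (hx₀ : 1 < x₀) (ht : x₀ ≤ t) : |wtDeriv t| ≤ uw x₀ / x₀ ^ 2 := by
  have ht1 : 1 < t := by linarith
  rw [abs_wtDeriv_eq ht1]
  have hu0 : 0 ≤ uw t := uw_nonneg ht1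
  have hx00 : 0 < x₀ := by linarith
  calc uw t / t ^ 2 ≤ uw x₀ / t ^ 2 := div_le_div_of_nonneg_right (uw_antitone hx₀ ht) (by positivity)
    _ ≤ uw x₀ / x₀ ^ 2 := div_le_div_of_nonneg_left (uw_nonneg hx₀) (by positivity) (by gcongr)

/-- `w'` is continuous on `(1, ∞)`. [folklore] -/
private theorem continuousOn_wtDeriv : ContinuousOn wtDeriv (Ioi 1) := by
  have hl : ContinuousOn Real.log (Ioi (1 : ℝ)) :=
    Real.continuousOn_log.mono fun t ht ↦ by simp only [mem_Ioi] at ht; simp; linarith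
  have h : ContinuousOn (fun t : ℝ ↦ -(Real.log t + 2) / (t ^ 2 * Real.log t ^ 3)) (Ioi 1) := by
    refine ContinuousOn.div (hl.add continuousOn_const).neg ((continuousOn_id.pow 2).mul (hl.pow 3))
      fun t ht ↦ ?_
    simp only [mem_Ioi] at ht
    exact mul_ne_zero (by positivity) (pow_ne_zero _ (Real.log_pos ht).ne')
  exact h

/-- The `ρ`-th piece of Robin's `D`: `zeroTerm ρ x · w(x) − ∫_{x₀}^x zeroTerm ρ · w'`, in closed
form after two integrations by parts (`1 < x₀ ≤ x`):
`m(ρ)·[x^ρ/(ρ² log²x) + 2x^ρ/(ρ²(ρ+1) log³x) − x₀^ρ u(x₀)/(ρ²(ρ+1)) − (1/(ρ²(ρ+1)))∫_{x₀}^x t^ρ u'(t) dt]`.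
[cite: Nicolas2017, Lemma 3.2 (proof: partial integration)] -/
theorem zeroPiece_eq (ρ : Zeros) {x₀ x : ℝ} (hx₀ : 1 < x₀) (hx : x₀ ≤ x) :
    zeroTerm ρ x * (wt x : ℂ) - ∫ t in x₀..x, zeroTerm ρ t * (wtDeriv t : ℂ) =
      (riemannZetaZeroOrder (ρ : ℂ) : ℂ) *
        ((x : ℂ) ^ (ρ : ℂ) / ((ρ : ℂ) ^ 2 * (Real.log x : ℂ) ^ 2) +
          2 * (x : ℂ) ^ (ρ : ℂ) / ((ρ : ℂ) ^ 2 * (ρ + 1) * (Real.log x : ℂ) ^ 3) -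
          (x₀ : ℂ) ^ (ρ : ℂ) * (uw x₀ : ℂ) / ((ρ : ℂ) ^ 2 * (ρ + 1)) -
          (1 / ((ρ : ℂ) ^ 2 * (ρ + 1))) * ∫ t in x₀..x, (t : ℂ) ^ (ρ : ℂ) * (uwDeriv t : ℂ)) := by
  have hx1 : 1 < x := hx₀.trans_le hx
  have hρ0 : (ρ : ℂ) ≠ 0 := ne_zero ρ.2
  have hρ1 : (ρ : ℂ) + 1 ≠ 0 := add_one_ne_zero ρ.2
  have hlog : (Real.log x : ℂ) ≠ 0 := by exact_mod_cast (Real.log_pos hx1).ne'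
  -- the integral
  have hint : ∫ t in x₀..x, zeroTerm ρ t * (wtDeriv t : ℂ) =
      -((riemannZetaZeroOrder (ρ : ℂ) : ℂ) / ((ρ : ℂ) * (ρ + 1))) *
        ∫ t in x₀..x, (t : ℂ) ^ ((ρ : ℂ) - 1) * (uw t : ℂ) := by
    rw [← intervalIntegral.integral_const_mul]
    refine intervalIntegral.integral_congr fun t ht ↦ ?_
    rw [uIcc_of_le hx] at ht
    have ht1 : 1 < t := hx₀.trans_le ht.1
    simp only [zeroTerm]
    rw [mul_assoc, ← mul_div_right_comm, cpow_add_one_mul_wtDeriv ht1]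
    field_simp
  have hbd : zeroTerm ρ x * (wt x : ℂ) =
      (riemannZetaZeroOrder (ρ : ℂ) : ℂ) / ((ρ : ℂ) * (ρ + 1)) * ((x : ℂ) ^ (ρ : ℂ) / (Real.log x : ℂ) ^ 2) := by
    simp only [zeroTerm]
    rw [mul_assoc, ← mul_div_right_comm, cpow_add_one_mul_wt hx1]
    field_simp
  have hux : (uw x : ℂ) = ((Real.log x : ℂ) + 2) / (Real.log x : ℂ) ^ 3 := by
    rw [uw]; push_cast; ring
  rw [hbd, hint, integral_cpow_mul_uw hρ0 hx₀ hx, hux]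
  field_simp
  ring

/-- Under RH, `‖x^ρ‖ = √x` at a non-trivial zero (`x > 0`). [folklore] -/
private theorem norm_cpow_zero (hRH : RiemannHypothesis) (ρ : Zeros) {x : ℝ} (hx : 0 < x) :
    ‖(x : ℂ) ^ (ρ : ℂ)‖ = Real.sqrt x := by
  rw [Complex.norm_cpow_eq_rpow_re_of_pos hx, re_eq_half_of_RH hRH ρ.2, Real.sqrt_eq_rpow]

/-- `‖ρ²(ρ+1)‖ ≥ ‖ρ‖³` (`Re ρ > 0`). [folklore] -/
private theorem norm_cube_le (ρ : Zeros) : ‖(ρ : ℂ)‖ ^ 3 ≤ ‖(ρ : ℂ) ^ 2 * ((ρ : ℂ) + 1)‖ := by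
  rw [norm_mul, norm_pow, pow_succ]
  exact mul_le_mul_of_nonneg_left (norm_le_norm_add_one ρ.2) (by positivity)

/-- **Size of the `ρ`-th piece under RH** (`1 < x₀ ≤ x`):
`‖piece‖ ≤ (m/|ρ|²)·√x/log²x + (m/|ρ|³)·(2√x/log³x + √x₀ u(x₀) + ∫_{x₀}^x √t |u'(t)| dt)`.
[cite: Nicolas2017, (1.3) and Lemma 3.2] -/
theorem norm_zeroPiece_le (hRH : RiemannHypothesis) (ρ : Zeros) {x₀ x : ℝ} (hx₀ : 1 < x₀) (hx : x₀ ≤ x) :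
    ‖zeroTerm ρ x * (wt x : ℂ) - ∫ t in x₀..x, zeroTerm ρ t * (wtDeriv t : ℂ)‖ ≤
      (riemannZetaZeroOrder (ρ : ℂ) : ℝ) / ‖(ρ : ℂ)‖ ^ 2 * (Real.sqrt x / Real.log x ^ 2) +
      (riemannZetaZeroOrder (ρ : ℂ) : ℝ) / ‖(ρ : ℂ)‖ ^ 3 *
        (2 * Real.sqrt x / Real.log x ^ 3 + Real.sqrt x₀ * uw x₀ +
          ∫ t in x₀..x, Real.sqrt t * |uwDeriv t|) := by
  have hx1 : 1 < x := hx₀.trans_le hx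
  have hx00 : 0 < x₀ := by linarith
  have hxpos : 0 < x := by linarith
  have hlx : 0 < Real.log x := Real.log_pos hx1
  have hm := zeroOrder_nonneg' ρ
  have hn0 : 0 < ‖(ρ : ℂ)‖ := norm_pos_iff.2 (ne_zero ρ.2)
  have hρ0 : (ρ : ℂ) ≠ 0 := ne_zero ρ.2
  have hρ1 : (ρ : ℂ) + 1 ≠ 0 := add_one_ne_zero ρ.2
  have hden : 0 < ‖(ρ : ℂ) ^ 2 * ((ρ : ℂ) + 1)‖ := norm_pos_iff.2 (mul_ne_zero (pow_ne_zero _ hρ0) hρ1)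
  have hcube := norm_cube_le ρ
  have hn3 : 0 < ‖(ρ : ℂ)‖ ^ 3 := by positivity
  rw [zeroPiece_eq ρ hx₀ hx, norm_mul, Complex.norm_intCast, abs_of_nonneg hm]
  -- the four terms
  have hsx := norm_cpow_zero hRH ρ hxpos
  have hsx₀ := norm_cpow_zero hRH ρ hx00
  have hlogn : ‖(Real.log x : ℂ)‖ = Real.log x := by
    rw [Complex.norm_real, Real.norm_eq_abs, abs_of_pos hlx]
  have h1 : ‖(x : ℂ) ^ (ρ : ℂ) / ((ρ : ℂ) ^ 2 * (Real.log x : ℂ) ^ 2)‖ =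
      Real.sqrt x / Real.log x ^ 2 / ‖(ρ : ℂ)‖ ^ 2 := by
    rw [norm_div, norm_mul, norm_pow, norm_pow, hsx, hlogn]
    field_simp
  have h2 : ‖2 * (x : ℂ) ^ (ρ : ℂ) / ((ρ : ℂ) ^ 2 * (ρ + 1) * (Real.log x : ℂ) ^ 3)‖ ≤
      2 * Real.sqrt x / Real.log x ^ 3 / ‖(ρ : ℂ)‖ ^ 3 := by
    rw [norm_div, norm_mul, norm_mul, Complex.norm_ofNat, norm_pow, hsx, hlogn,
      mul_comm (‖(ρ : ℂ) ^ 2 * ((ρ : ℂ) + 1)‖) (Real.log x ^ 3), ← div_div]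
    exact div_le_div_of_nonneg_left (by positivity) hn3 hcube
  have h3 : ‖(x₀ : ℂ) ^ (ρ : ℂ) * (uw x₀ : ℂ) / ((ρ : ℂ) ^ 2 * (ρ + 1))‖ ≤
      Real.sqrt x₀ * uw x₀ / ‖(ρ : ℂ)‖ ^ 3 := by
    rw [norm_div, norm_mul, hsx₀, Complex.norm_real, Real.norm_eq_abs, abs_of_nonneg (uw_nonneg hx₀)]
    exact div_le_div_of_nonneg_left (mul_nonneg (Real.sqrt_nonneg _) (uw_nonneg hx₀)) hn3 hcube
  have h4 : ‖(1 / ((ρ : ℂ) ^ 2 * (ρ + 1))) * ∫ t in x₀..x, (t : ℂ) ^ (ρ : ℂ) * (uwDeriv t : ℂ)‖ ≤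
      (∫ t in x₀..x, Real.sqrt t * |uwDeriv t|) / ‖(ρ : ℂ)‖ ^ 3 := by
    rw [norm_mul, norm_div, norm_one]
    have hI : ‖∫ t in x₀..x, (t : ℂ) ^ (ρ : ℂ) * (uwDeriv t : ℂ)‖ ≤
        ∫ t in x₀..x, Real.sqrt t * |uwDeriv t| := by
      refine (intervalIntegral.norm_integral_le_integral_norm hx).trans_eq ?_
      refine intervalIntegral.integral_congr fun t ht ↦ ?_
      rw [uIcc_of_le hx] at ht
      have ht0 : 0 < t := by linarith [ht.1]
      simp only [norm_mul, Complex.norm_real, Real.norm_eq_abs]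
      rw [norm_cpow_zero hRH ρ ht0]
    have hI0 : 0 ≤ ∫ t in x₀..x, Real.sqrt t * |uwDeriv t| :=
      intervalIntegral.integral_nonneg hx fun t _ ↦ by positivity
    calc 1 / ‖(ρ : ℂ) ^ 2 * ((ρ : ℂ) + 1)‖ * ‖∫ t in x₀..x, (t : ℂ) ^ (ρ : ℂ) * (uwDeriv t : ℂ)‖
        ≤ 1 / ‖(ρ : ℂ)‖ ^ 3 * ∫ t in x₀..x, Real.sqrt t * |uwDeriv t| :=
          mul_le_mul (div_le_div_of_nonneg_left zero_le_one hn3 hcube) hI (norm_nonneg _) (by positivity)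
      _ = _ := by ring
  -- combine
  have htri : ‖(x : ℂ) ^ (ρ : ℂ) / ((ρ : ℂ) ^ 2 * (Real.log x : ℂ) ^ 2) +
        2 * (x : ℂ) ^ (ρ : ℂ) / ((ρ : ℂ) ^ 2 * (ρ + 1) * (Real.log x : ℂ) ^ 3) -
        (x₀ : ℂ) ^ (ρ : ℂ) * (uw x₀ : ℂ) / ((ρ : ℂ) ^ 2 * (ρ + 1)) -
        (1 / ((ρ : ℂ) ^ 2 * (ρ + 1))) * ∫ t in x₀..x, (t : ℂ) ^ (ρ : ℂ) * (uwDeriv t : ℂ)‖ ≤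
      Real.sqrt x / Real.log x ^ 2 / ‖(ρ : ℂ)‖ ^ 2 +
        (2 * Real.sqrt x / Real.log x ^ 3 / ‖(ρ : ℂ)‖ ^ 3 + Real.sqrt x₀ * uw x₀ / ‖(ρ : ℂ)‖ ^ 3 +
          (∫ t in x₀..x, Real.sqrt t * |uwDeriv t|) / ‖(ρ : ℂ)‖ ^ 3) := by
    refine (norm_sub_le _ _).trans ?_
    refine (add_le_add ((norm_sub_le _ _).trans (add_le_add ((norm_add_le _ _).trans
      (add_le_add h1.le h2)) h3)) h4).trans_eq ?_
    ring
  refine (mul_le_mul_of_nonneg_left htri hm).trans_eq ?_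
  field_simp


/-! ### §3. The sum over the zeros -/

/-- `λ₃ = ∑_ρ m(ρ)/|ρ|³` (the weight of the lower-order zero terms). [folklore] -/
def lam3 : ℝ := ∑' ρ : Zeros, (riemannZetaZeroOrder (ρ : ℂ) : ℝ) / ‖(ρ : ℂ)‖ ^ 3

/-- Under RH, `|ρ| ≥ 1/2`. [folklore] -/
private theorem half_le_norm (hRH : RiemannHypothesis) (ρ : Zeros) : 1 / 2 ≤ ‖(ρ : ℂ)‖ := by
  have h := Complex.abs_re_le_norm (ρ : ℂ)
  rw [re_eq_half_of_RH hRH ρ.2] at h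
  exact (le_abs_self _).trans h

/-- Under RH, `m/|ρ|³ ≤ 2 m/|ρ|²`, so `λ₃` converges (`≤ 2λ`). [folklore] -/
private theorem summable_lam3 (hRH : RiemannHypothesis) :
    Summable fun ρ : Zeros ↦ (riemannZetaZeroOrder (ρ : ℂ) : ℝ) / ‖(ρ : ℂ)‖ ^ 3 := by
  refine Summable.of_nonneg_of_le (fun ρ ↦ div_nonneg (zeroOrder_nonneg' ρ) (by positivity))
    (fun ρ ↦ ?_) ((hasSum_zeroOrder_div_norm_sq_of_RH hRH).summable.mul_left 2)
  have hn : 1 / 2 ≤ ‖(ρ : ℂ)‖ := half_le_norm hRH ρ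
  have hn0 : 0 < ‖(ρ : ℂ)‖ := by linarith
  have hm := zeroOrder_nonneg' ρ
  rw [div_le_iff₀ (by positivity)]
  have : (riemannZetaZeroOrder (ρ : ℂ) : ℝ) * 1 ≤ (riemannZetaZeroOrder (ρ : ℂ) : ℝ) * (2 * ‖(ρ : ℂ)‖) :=
    mul_le_mul_of_nonneg_left (by linarith) hm
  calc (riemannZetaZeroOrder (ρ : ℂ) : ℝ) = (riemannZetaZeroOrder (ρ : ℂ) : ℝ) * 1 := (mul_one _).symm
    _ ≤ (riemannZetaZeroOrder (ρ : ℂ) : ℝ) * (2 * ‖(ρ : ℂ)‖) := this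
    _ = 2 * ((riemannZetaZeroOrder (ρ : ℂ) : ℝ) / ‖(ρ : ℂ)‖ ^ 2) * ‖(ρ : ℂ)‖ ^ 3 := by
        field_simp

/-- `λ₃ ≥ 0`. [folklore] -/
private theorem lam3_nonneg : 0 ≤ lam3 :=
  tsum_nonneg fun ρ ↦ div_nonneg (zeroOrder_nonneg' ρ) (by positivity)

/-- Each `zeroTerm ρ · w'` is continuous on `(1, ∞)`. [folklore] -/
private theorem continuousOn_zeroTerm_mul_wtDeriv (ρ : Zeros) :
    ContinuousOn (fun t : ℝ ↦ zeroTerm ρ t * (wtDeriv t : ℂ)) (Ioi 1) := by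
  have hc : Continuous fun t : ℝ ↦ (t : ℂ) ^ ((ρ : ℂ) + 1) :=
    Complex.continuous_ofReal_cpow_const (by rw [Complex.add_re, Complex.one_re]; linarith [re_pos ρ.2])
  have hz : Continuous fun t : ℝ ↦ zeroTerm ρ t := continuous_const.mul (hc.div_const _)
  exact hz.continuousOn.mul (Complex.continuous_ofReal.comp_continuousOn continuousOn_wtDeriv)

/-- **`∫_{x₀}^x Z w' = ∑_ρ ∫_{x₀}^x zeroTerm ρ · w'`** (`1 < x₀ ≤ x`; dominated convergence: on
`[x₀, x]` the `ρ`-th term is bounded by `x² ‖zeroTerm ρ 1‖ u(x₀)/x₀²`). [folklore] -/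
private theorem hasSum_integral_zeroTerm_mul_wtDeriv {x₀ x : ℝ} (hx₀ : 1 < x₀) (hx : x₀ ≤ x) :
    HasSum (fun ρ : Zeros ↦ ∫ t in x₀..x, zeroTerm ρ t * (wtDeriv t : ℂ))
      (∫ t in x₀..x, Zsum t * (wtDeriv t : ℂ)) := by
  have hsub : Set.uIoc x₀ x ⊆ Ioi 1 := by
    rw [uIoc_of_le hx]; exact fun t ht ↦ hx₀.trans ht.1
  refine intervalIntegral.hasSum_integral_of_dominated_convergence
    (fun ρ _ ↦ x ^ 2 * ‖zeroTerm ρ 1‖ * (uw x₀ / x₀ ^ 2)) (fun ρ ↦ ?_) (fun ρ ↦ ?_) ?_ ?_ ?_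
  · exact ((continuousOn_zeroTerm_mul_wtDeriv ρ).mono hsub).aestronglyMeasurable measurableSet_uIoc
  · refine ae_of_all _ fun t ht ↦ ?_
    rw [uIoc_of_le hx] at ht
    have ht1 : 1 ≤ t := (hx₀.trans ht.1).le
    rw [norm_mul, Complex.norm_real, Real.norm_eq_abs]
    exact mul_le_mul (norm_zeroTerm_le_sq_mul ρ ⟨ht1, ht.2⟩) (abs_wtDeriv_le hx₀ ht.1.le)
      (abs_nonneg _) (by positivity)
  · exact ae_of_all _ fun t _ ↦ ((summable_norm_psiOne_zeroTerm le_rfl).mul_left _).mul_right _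
  · exact intervalIntegrable_const
  · refine ae_of_all _ fun t ht ↦ ?_
    have ht1 : 1 ≤ t := le_of_lt (hsub ht)
    exact (summable_zeroTerm ht1).hasSum.mul_right _

/-- The zero bracket as a convergent sum of the pieces of §2 (`1 < x₀ ≤ x`). [folklore] -/
private theorem hasSum_zeroPiece {x₀ x : ℝ} (hx₀ : 1 < x₀) (hx : x₀ ≤ x) :
    HasSum (fun ρ : Zeros ↦ zeroTerm ρ x * (wt x : ℂ) - ∫ t in x₀..x, zeroTerm ρ t * (wtDeriv t : ℂ))
      (Zsum x * (wt x : ℂ) - ∫ t in x₀..x, Zsum t * (wtDeriv t : ℂ)) :=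
  ((summable_zeroTerm (hx₀.le.trans hx)).hasSum.mul_right _).sub
    (hasSum_integral_zeroTerm_mul_wtDeriv hx₀ hx)

/-- **The zero bracket under RH** (`1 < x₀ ≤ x`):
`‖Z(x) w(x) − ∫_{x₀}^x Z w'‖ ≤ λ √x/log²x + λ₃ (2√x/log³x + √x₀ u(x₀) + ∫_{x₀}^x √t |u'(t)| dt)`,
`λ = nicolasBeta = ∑ m(ρ)/|ρ|²`. [cite: Nicolas2017, (1.3) and Lemma 3.2] -/
theorem norm_zeroBracket_le (hRH : RiemannHypothesis) {x₀ x : ℝ} (hx₀ : 1 < x₀) (hx : x₀ ≤ x) :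
    ‖Zsum x * (wt x : ℂ) - ∫ t in x₀..x, Zsum t * (wtDeriv t : ℂ)‖ ≤
      nicolasBeta * (Real.sqrt x / Real.log x ^ 2) +
        lam3 * (2 * Real.sqrt x / Real.log x ^ 3 + Real.sqrt x₀ * uw x₀ +
          ∫ t in x₀..x, Real.sqrt t * |uwDeriv t|) := by
  set A : ℝ := Real.sqrt x / Real.log x ^ 2
  set B : ℝ := 2 * Real.sqrt x / Real.log x ^ 3 + Real.sqrt x₀ * uw x₀ +
    ∫ t in x₀..x, Real.sqrt t * |uwDeriv t|
  have hS := hasSum_zeroPiece hx₀ hx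
  have hb : ∀ ρ : Zeros, ‖zeroTerm ρ x * (wt x : ℂ) - ∫ t in x₀..x, zeroTerm ρ t * (wtDeriv t : ℂ)‖ ≤
      (riemannZetaZeroOrder (ρ : ℂ) : ℝ) / ‖(ρ : ℂ)‖ ^ 2 * A +
        (riemannZetaZeroOrder (ρ : ℂ) : ℝ) / ‖(ρ : ℂ)‖ ^ 3 * B :=
    fun ρ ↦ norm_zeroPiece_le hRH ρ hx₀ hx
  have hB : HasSum (fun ρ : Zeros ↦ (riemannZetaZeroOrder (ρ : ℂ) : ℝ) / ‖(ρ : ℂ)‖ ^ 2 * A +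
      (riemannZetaZeroOrder (ρ : ℂ) : ℝ) / ‖(ρ : ℂ)‖ ^ 3 * B) (nicolasBeta * A + lam3 * B) :=
    ((hasSum_zeroOrder_div_norm_sq_of_RH hRH).mul_right A).add ((summable_lam3 hRH).hasSum.mul_right B)
  have hsn : Summable fun ρ : Zeros ↦
      ‖zeroTerm ρ x * (wt x : ℂ) - ∫ t in x₀..x, zeroTerm ρ t * (wtDeriv t : ℂ)‖ :=
    Summable.of_nonneg_of_le (fun _ ↦ norm_nonneg _) hb hB.summable
  calc ‖Zsum x * (wt x : ℂ) - ∫ t in x₀..x, Zsum t * (wtDeriv t : ℂ)‖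
      = ‖∑' ρ : Zeros, (zeroTerm ρ x * (wt x : ℂ) - ∫ t in x₀..x, zeroTerm ρ t * (wtDeriv t : ℂ))‖ := by
        rw [hS.tsum_eq]
    _ ≤ ∑' ρ : Zeros, ‖zeroTerm ρ x * (wt x : ℂ) - ∫ t in x₀..x, zeroTerm ρ t * (wtDeriv t : ℂ)‖ :=
        norm_tsum_le_tsum_norm hsn
    _ ≤ ∑' ρ : Zeros, ((riemannZetaZeroOrder (ρ : ℂ) : ℝ) / ‖(ρ : ℂ)‖ ^ 2 * A +
        (riemannZetaZeroOrder (ρ : ℂ) : ℝ) / ‖(ρ : ℂ)‖ ^ 3 * B) := hsn.tsum_le_tsum hb hB.summable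
    _ = nicolasBeta * A + lam3 * B := hB.tsum_eq

/-! ### §4. The linear term, the remainder term, and `D` itself -/

/-- `∫_{x₀}^x w' = w(x) − w(x₀)` (`1 < x₀ ≤ x`). [folklore] -/
private theorem integral_wtDeriv {x₀ x : ℝ} (hx₀ : 1 < x₀) (hx : x₀ ≤ x) :
    ∫ t in x₀..x, wtDeriv t = wt x - wt x₀ := by
  have hmem : ∀ t ∈ uIcc x₀ x, 1 < t := fun t ht ↦ by
    rw [uIcc_of_le hx] at ht; exact hx₀.trans_le ht.1
  exact intervalIntegral.integral_eq_sub_of_hasDerivAt (fun t ht ↦ hasDerivAt_wt (hmem t ht))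
    ((continuousOn_wtDeriv.mono hmem).intervalIntegrable)

/-- **The linear term**: `∫_{x₀}^x t w'(t) dt = (1/log x + 1/log²x) − (1/log x₀ + 1/log²x₀)`
(`t w'(t) = (1/log t + 1/log² t)'`). [folklore] -/
private theorem integral_id_mul_wtDeriv {x₀ x : ℝ} (hx₀ : 1 < x₀) (hx : x₀ ≤ x) :
    ∫ t in x₀..x, t * wtDeriv t =
      (1 / Real.log x + 1 / Real.log x ^ 2) - (1 / Real.log x₀ + 1 / Real.log x₀ ^ 2) := by
  have hmem : ∀ t ∈ uIcc x₀ x, 1 < t := fun t ht ↦ by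
    rw [uIcc_of_le hx] at ht; exact hx₀.trans_le ht.1
  have hd : ∀ t ∈ uIcc x₀ x, HasDerivAt (fun s : ℝ ↦ (Real.log s)⁻¹ + (Real.log s ^ 2)⁻¹)
      (t * wtDeriv t) t := by
    intro t ht
    have ht1 := hmem t ht
    have ht0 : t ≠ 0 := by linarith
    have hlog : Real.log t ≠ 0 := (Real.log_pos ht1).ne'
    have h1 : HasDerivAt (fun s : ℝ ↦ (Real.log s)⁻¹) (-(t⁻¹) / Real.log t ^ 2) t :=
      (Real.hasDerivAt_log ht0).inv hlog
    have h2 : HasDerivAt (fun s : ℝ ↦ (Real.log s ^ 2)⁻¹)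
        (-((2 : ℕ) * Real.log t ^ (2 - 1) * t⁻¹) / (Real.log t ^ 2) ^ 2) t :=
      ((Real.hasDerivAt_log ht0).pow 2).inv (pow_ne_zero _ hlog)
    refine (h1.add h2).congr_deriv ?_
    rw [wtDeriv]
    push_cast
    field_simp
    ring
  have hc : ContinuousOn (fun t : ℝ ↦ t * wtDeriv t) (uIcc x₀ x) :=
    (continuousOn_id.mul continuousOn_wtDeriv).mono hmem
  rw [intervalIntegral.integral_eq_sub_of_hasDerivAt hd hc.intervalIntegrable]
  simp only [one_div]

/-- `E w'` in real form is continuous on `(1, ∞)`. [folklore] -/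
private theorem continuousOn_reE_mul_wtDeriv :
    ContinuousOn (fun t : ℝ ↦ (psiOneRemainder t).re * wtDeriv t) (Ioi 1) := by
  have h1 : ContinuousOn (fun t : ℝ ↦ (psiOneRemainder t).re) (Ioi 1) :=
    (Complex.continuous_re.comp_continuousOn continuousOn_psiOneRemainder).mono fun _ ht ↦
      mem_Ici.2 (le_of_lt (mem_Ioi.1 ht))
  exact h1.mul continuousOn_wtDeriv

/-- **The remainder bracket**: for `1 < x₀ ≤ x`,
`EB(x) := ∫_{x₀}^x Re E · w' − Re E(x) w(x)` satisfies `−Re E(x) w(x₀) ≤ EB ≤ −Re E(x₀) w(x₀)`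
(`Re E` non-decreasing, `w' ≤ 0`). [cite: MontgomeryVaughan2007, §12.1.1 Exercise 6] -/
theorem eBracket_mem {x₀ x : ℝ} (hx₀ : 1 < x₀) (hx : x₀ ≤ x) :
    -(psiOneRemainder x).re * wt x₀ ≤
        (∫ t in x₀..x, (psiOneRemainder t).re * wtDeriv t) - (psiOneRemainder x).re * wt x ∧
      (∫ t in x₀..x, (psiOneRemainder t).re * wtDeriv t) - (psiOneRemainder x).re * wt x ≤
        -(psiOneRemainder x₀).re * wt x₀ := by
  have hmem : ∀ t ∈ uIcc x₀ x, 1 < t := fun t ht ↦ by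
    rw [uIcc_of_le hx] at ht; exact hx₀.trans_le ht.1
  have hw := integral_wtDeriv hx₀ hx
  have hint : IntervalIntegrable (fun t : ℝ ↦ (psiOneRemainder t).re * wtDeriv t) volume x₀ x :=
    (continuousOn_reE_mul_wtDeriv.mono hmem).intervalIntegrable
  have hintc : ∀ c : ℝ, IntervalIntegrable (fun t : ℝ ↦ c * wtDeriv t) volume x₀ x := fun c ↦
    ((continuousOn_const.mul continuousOn_wtDeriv).mono hmem).intervalIntegrable
  have hneg : ∀ t ∈ Icc x₀ x, wtDeriv t ≤ 0 := by
    intro t ht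
    have ht1 : 1 < t := hx₀.trans_le ht.1
    have hl := Real.log_pos ht1
    rw [wtDeriv, div_nonpos_iff]
    exact Or.inr ⟨by linarith, by positivity⟩
  have hlo : ∫ t in x₀..x, (psiOneRemainder x).re * wtDeriv t ≤
      ∫ t in x₀..x, (psiOneRemainder t).re * wtDeriv t := by
    refine intervalIntegral.integral_mono_on hx (hintc _) hint fun t ht ↦ ?_
    exact mul_le_mul_of_nonpos_right (re_psiOneRemainder_mono (hx₀.trans_le ht.1) ht.2) (hneg t ht)
  have hhi : ∫ t in x₀..x, (psiOneRemainder t).re * wtDeriv t ≤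
      ∫ t in x₀..x, (psiOneRemainder x₀).re * wtDeriv t := by
    refine intervalIntegral.integral_mono_on hx hint (hintc _) fun t ht ↦ ?_
    exact mul_le_mul_of_nonpos_right (re_psiOneRemainder_mono hx₀ ht.1) (hneg t ht)
  rw [intervalIntegral.integral_const_mul, hw] at hlo hhi
  have hmono := re_psiOneRemainder_mono hx₀ hx
  have hwx : 0 ≤ wt x := by
    have : 0 < x * Real.log x ^ 2 := by
      have := Real.log_pos (hx₀.trans_le hx)
      have hx0 : 0 < x := by linarith
      positivity
    exact (inv_pos.2 this).le
  constructor
  · nlinarith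
  · nlinarith [mul_le_mul_of_nonneg_right hmono hwx]

/-- `F(x) − F(x₀) = ∫_{x₀}^x R w'` (`2 ≤ x₀ ≤ x`; FTC for the continuous right-differentiable
`F = D + R w`). [cite: Robin1984Toulouse, §4 (15)] -/
theorem robinF_sub_eq_integral {x₀ x : ℝ} (hx₀ : 2 ≤ x₀) (hx : x₀ ≤ x) :
    robinF x - robinF x₀ = ∫ t in x₀..x, psiOneErr t * wtDeriv t := by
  have hcont : ContinuousOn robinF (Icc x₀ x) := continuousOn_robinF.mono fun t ht ↦ hx₀.trans ht.1
  have hint : IntervalIntegrable (fun t : ℝ ↦ psiOneErr t * wtDeriv t) volume x₀ x := by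
    refine ContinuousOn.intervalIntegrable ?_
    rw [uIcc_of_le hx]
    refine (NicolasJ.continuous_Rone.continuousOn).mul (continuousOn_wtDeriv.mono fun t ht ↦ ?_)
    exact lt_of_lt_of_le (by linarith) ht.1
  rw [intervalIntegral.integral_eq_sub_of_hasDeriv_right_of_le hx hcont
    (fun t ht ↦ hasDerivWithinAt_robinF (hx₀.trans ht.1.le)) hint]

/-- Pointwise form of the explicit formula: `R(t) = −Re Z(t) − t log 2π + Re E(t)` (`t ≥ 1`).
[cite: MontgomeryVaughan2007, (13.7)] -/
theorem psiOneErr_eq_re {t : ℝ} (ht : 1 ≤ t) :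
    psiOneErr t = -(Zsum t).re - t * Real.log (2 * π) + (psiOneRemainder t).re := by
  have h := congrArg Complex.re (Rone_eq_explicit ht)
  rw [log_two_pi] at h
  simp only [Complex.ofReal_re, Complex.add_re, Complex.sub_re, Complex.neg_re,
    Complex.re_mul_ofReal] at h
  rw [show psiOneErr t = NicolasJ.Rone t from rfl, h]

/-- **Robin's `D` in brackets** (`2 ≤ x₀ ≤ x`):
`D(x) = F(x₀) + Re[Z(x)w(x) − ∫_{x₀}^x Z w'] + log 2π·(x w(x) − ∫_{x₀}^x t w') + (∫_{x₀}^x Re E·w' − Re E(x) w(x))`.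
[cite: Robin1984Toulouse, §4 (13)–(16); Nicolas2017, Prop. 3.1] -/
theorem robinD_eq_brackets {x₀ x : ℝ} (hx₀ : 2 ≤ x₀) (hx : x₀ ≤ x) :
    robinD x = robinF x₀ +
      (Zsum x * (wt x : ℂ) - ∫ t in x₀..x, Zsum t * (wtDeriv t : ℂ)).re +
      Real.log (2 * π) * (x * wt x - ∫ t in x₀..x, t * wtDeriv t) +
      ((∫ t in x₀..x, (psiOneRemainder t).re * wtDeriv t) - (psiOneRemainder x).re * wt x) := by
  have hx₀1 : 1 < x₀ := by linarith
  have hx1 : 1 < x := by linarith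
  have hmem : ∀ t ∈ uIcc x₀ x, 1 < t := fun t ht ↦ by
    rw [uIcc_of_le hx] at ht; exact hx₀1.trans_le ht.1
  have hF := robinF_sub_eq_integral hx₀ hx
  have hD : robinD x = robinF x - psiOneErr x * wt x := by rw [robinF]; ring
  -- split the integral of `R w'`
  have hZi : IntervalIntegrable (fun t : ℝ ↦ Zsum t * (wtDeriv t : ℂ)) volume x₀ x :=
    ((continuousOn_Zsum.mono fun t ht ↦ (hmem t ht).le).mul
      (Complex.continuous_ofReal.comp_continuousOn (continuousOn_wtDeriv.mono hmem))).intervalIntegrable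
  have hZre : IntervalIntegrable (fun t : ℝ ↦ (Zsum t).re * wtDeriv t) volume x₀ x := by
    have h1 : ContinuousOn (fun t : ℝ ↦ (Zsum t).re) (uIcc x₀ x) :=
      (Complex.continuous_re.comp_continuousOn continuousOn_Zsum).mono fun t ht ↦ (hmem t ht).le
    exact (h1.mul (continuousOn_wtDeriv.mono hmem)).intervalIntegrable
  have hLi : IntervalIntegrable (fun t : ℝ ↦ t * wtDeriv t) volume x₀ x :=
    ((continuousOn_id.mul continuousOn_wtDeriv).mono hmem).intervalIntegrable
  have hEi : IntervalIntegrable (fun t : ℝ ↦ (psiOneRemainder t).re * wtDeriv t) volume x₀ x :=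
    (continuousOn_reE_mul_wtDeriv.mono hmem).intervalIntegrable
  have hsplit : ∫ t in x₀..x, psiOneErr t * wtDeriv t =
      -(∫ t in x₀..x, (Zsum t).re * wtDeriv t) - Real.log (2 * π) * (∫ t in x₀..x, t * wtDeriv t) +
        ∫ t in x₀..x, (psiOneRemainder t).re * wtDeriv t := by
    have e : ∫ t in x₀..x, psiOneErr t * wtDeriv t =
        ∫ t in x₀..x, (-((Zsum t).re * wtDeriv t) - Real.log (2 * π) * (t * wtDeriv t)) +
          (psiOneRemainder t).re * wtDeriv t := by
      refine intervalIntegral.integral_congr fun t ht ↦ ?_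
      show psiOneErr t * wtDeriv t = _
      rw [psiOneErr_eq_re (hmem t ht).le]
      ring
    have hZn : IntervalIntegrable (fun t : ℝ ↦ -((Zsum t).re * wtDeriv t)) volume x₀ x := hZre.neg
    have hLc : IntervalIntegrable (fun t : ℝ ↦ Real.log (2 * π) * (t * wtDeriv t)) volume x₀ x :=
      hLi.const_mul _
    rw [e, intervalIntegral.integral_add (hZn.sub hLc) hEi, intervalIntegral.integral_sub hZn hLc,
      intervalIntegral.integral_neg, intervalIntegral.integral_const_mul]
  have hre : (∫ t in x₀..x, (Zsum t).re * wtDeriv t) = (∫ t in x₀..x, Zsum t * (wtDeriv t : ℂ)).re := by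
    have h := Complex.reCLM.intervalIntegral_comp_comm hZi
    simp only [Complex.reCLM_apply, Complex.re_mul_ofReal] at h
    exact h
  have hF' : robinF x = robinF x₀ + ∫ t in x₀..x, psiOneErr t * wtDeriv t := by linarith
  rw [hD, hF', hsplit, hre, psiOneErr_eq_re hx1.le]
  have hw : (Zsum x * (wt x : ℂ)).re = (Zsum x).re * wt x := Complex.re_mul_ofReal _ _
  simp only [Complex.sub_re, hw]
  ring


/-! ### §5. The lower-order integral and the bound for `D` under RH -/

/-- `∫_{x₀}^x √t |u'(t)| dt ≤ (2 + 6/log x₀) ∫_{x₀}^x dt/(√t log³ t)` (`1 < x₀ ≤ x`). [folklore] -/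
private theorem integral_sqrt_mul_abs_uwDeriv_le {x₀ x : ℝ} (hx₀ : 1 < x₀) (hx : x₀ ≤ x) :
    ∫ t in x₀..x, Real.sqrt t * |uwDeriv t| ≤
      (2 + 6 / Real.log x₀) * ∫ t in x₀..x, 1 / (Real.sqrt t * Real.log t ^ 3) := by
  have hmem : ∀ t ∈ uIcc x₀ x, 1 < t := fun t ht ↦ by
    rw [uIcc_of_le hx] at ht; exact hx₀.trans_le ht.1
  have hl : ContinuousOn Real.log (uIcc x₀ x) :=
    Real.continuousOn_log.mono fun t ht ↦ by have := hmem t ht; simp; linarith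
  have hc1 : ContinuousOn (fun t : ℝ ↦ Real.sqrt t * |uwDeriv t|) (uIcc x₀ x) :=
    Real.continuous_sqrt.continuousOn.mul ((continuousOn_uwDeriv.mono hmem).abs)
  have hc2 : ContinuousOn (fun t : ℝ ↦ 1 / (Real.sqrt t * Real.log t ^ 3)) (uIcc x₀ x) := by
    refine continuousOn_const.div (Real.continuous_sqrt.continuousOn.mul (hl.pow 3)) fun t ht ↦ ?_
    have := hmem t ht
    exact mul_ne_zero (Real.sqrt_pos.2 (by linarith)).ne' (pow_ne_zero _ (Real.log_pos this).ne')
  rw [← intervalIntegral.integral_const_mul]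
  refine intervalIntegral.integral_mono_on hx hc1.intervalIntegrable
    ((hc2.intervalIntegrable).const_mul _) fun t ht ↦ ?_
  have ht1 : 1 < t := hx₀.trans_le ht.1
  have ht0 : 0 < t := by linarith
  have hl0 : 0 < Real.log t := Real.log_pos ht1
  have hs0 : 0 < Real.sqrt t := Real.sqrt_pos.2 ht0
  have hu := abs_uwDeriv_le hx₀ ht.1
  calc Real.sqrt t * |uwDeriv t| ≤ Real.sqrt t * ((2 + 6 / Real.log x₀) / (t * Real.log t ^ 3)) :=
        mul_le_mul_of_nonneg_left hu hs0.le
    _ = (2 + 6 / Real.log x₀) * (1 / (Real.sqrt t * Real.log t ^ 3)) := by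
        rw [mul_div_assoc', mul_one_div, div_eq_div_iff (by positivity) (by positivity)]
        calc Real.sqrt t * (2 + 6 / Real.log x₀) * (Real.sqrt t * Real.log t ^ 3)
            = (Real.sqrt t * Real.sqrt t) * (2 + 6 / Real.log x₀) * Real.log t ^ 3 := by ring
          _ = (2 + 6 / Real.log x₀) * (t * Real.log t ^ 3) := by rw [Real.mul_self_sqrt ht0.le]; ring

/-- The comparison primitive `g(t) = 4√t/log³ t`, `g'(t) = (2 log t − 12)/(√t log⁴ t) ≥ 1/(√t log³ t)`
for `log t ≥ 12`. [folklore] -/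
private theorem hasDerivAt_sqrt_div_log_cube {t : ℝ} (ht : 1 < t) :
    HasDerivAt (fun s : ℝ ↦ 4 * Real.sqrt s / Real.log s ^ 3)
      ((2 * Real.log t - 12) / (Real.sqrt t * Real.log t ^ 4)) t := by
  have ht0 : 0 < t := by linarith
  have hlog : Real.log t ≠ 0 := (Real.log_pos ht).ne'
  have hs : HasDerivAt (fun s : ℝ ↦ 4 * Real.sqrt s) (4 * (1 / (2 * Real.sqrt t))) t :=
    (Real.hasDerivAt_sqrt ht0.ne').const_mul 4
  have hl : HasDerivAt (fun s : ℝ ↦ Real.log s ^ 3) ((3 : ℕ) * Real.log t ^ (3 - 1) * t⁻¹) t :=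
    (Real.hasDerivAt_log ht0.ne').pow 3
  have h := hs.div hl (pow_ne_zero _ hlog)
  refine h.congr_deriv ?_
  have hst : Real.sqrt t ≠ 0 := (Real.sqrt_pos.2 ht0).ne'
  have ht' : Real.sqrt t ^ 2 = t := Real.sq_sqrt ht0.le
  push_cast
  field_simp
  linear_combination (-24 : ℝ) * ht'

/-- **`∫_{x₀}^x dt/(√t log³ t) ≤ K₀ + 4√x/log³ x`** for all `x ≥ x₀ > 1`, with
`K₀ = ∫_{x₀}^{max(x₀, e¹²)} dt/(√t log³ t)`. [folklore] -/
private theorem integral_inv_sqrt_log_cube_le {x₀ x : ℝ} (hx₀ : 1 < x₀) (hx : x₀ ≤ x) :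
    ∫ t in x₀..x, 1 / (Real.sqrt t * Real.log t ^ 3) ≤
      (∫ t in x₀..max x₀ (Real.exp 12), 1 / (Real.sqrt t * Real.log t ^ 3)) +
        4 * Real.sqrt x / Real.log x ^ 3 := by
  set a : ℝ := max x₀ (Real.exp 12) with ha
  have hx₀a : x₀ ≤ a := le_max_left _ _
  have hea : Real.exp 12 ≤ a := le_max_right _ _
  have hf0 : ∀ t : ℝ, 1 < t → 0 ≤ 1 / (Real.sqrt t * Real.log t ^ 3) := fun t ht ↦ by
    have := Real.log_pos ht; positivity
  have hcont : ∀ {p q : ℝ}, x₀ ≤ p → p ≤ q →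
      IntervalIntegrable (fun t : ℝ ↦ 1 / (Real.sqrt t * Real.log t ^ 3)) volume p q := by
    intro p q hp hpq
    refine ContinuousOn.intervalIntegrable ?_
    rw [uIcc_of_le hpq]
    have hl : ContinuousOn Real.log (Icc p q) :=
      Real.continuousOn_log.mono fun t ht ↦ by simp; linarith [ht.1]
    refine continuousOn_const.div (Real.continuous_sqrt.continuousOn.mul (hl.pow 3)) fun t ht ↦ ?_
    have : 1 < t := by linarith [ht.1]
    exact mul_ne_zero (Real.sqrt_pos.2 (by linarith)).ne' (pow_ne_zero _ (Real.log_pos this).ne')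
  have hpos : 0 ≤ 4 * Real.sqrt x / Real.log x ^ 3 := by
    have := Real.log_pos (hx₀.trans_le hx); positivity
  rcases le_or_gt x a with hxa | hxa
  · -- `x ≤ a`: monotonicity of the integral of a non-negative function
    have hmono : ∫ t in x₀..x, 1 / (Real.sqrt t * Real.log t ^ 3) ≤
        ∫ t in x₀..a, 1 / (Real.sqrt t * Real.log t ^ 3) := by
      refine intervalIntegral.integral_mono_interval le_rfl hx hxa ?_ (hcont le_rfl hx₀a)
      rw [Filter.EventuallyLE, ae_restrict_iff' measurableSet_Ioc]
      exact Filter.Eventually.of_forall fun t ht ↦ hf0 t (hx₀.trans ht.1)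
    linarith
  · -- `x > a`: split at `a` and compare with the primitive `4√t/log³ t` on `[a, x]`
    have hsplit : ∫ t in x₀..x, 1 / (Real.sqrt t * Real.log t ^ 3) =
        (∫ t in x₀..a, 1 / (Real.sqrt t * Real.log t ^ 3)) +
          ∫ t in a..x, 1 / (Real.sqrt t * Real.log t ^ 3) :=
      (intervalIntegral.integral_add_adjacent_intervals (hcont le_rfl hx₀a) (hcont hx₀a hxa.le)).symm
    have ha1 : 1 < a := hx₀.trans_le hx₀a
    have hmem : ∀ t ∈ uIcc a x, 1 < t := fun t ht ↦ by
      rw [uIcc_of_le hxa.le] at ht; exact ha1.trans_le ht.1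
    have hderiv : ∀ t ∈ uIcc a x, HasDerivAt (fun s : ℝ ↦ 4 * Real.sqrt s / Real.log s ^ 3)
        ((2 * Real.log t - 12) / (Real.sqrt t * Real.log t ^ 4)) t := fun t ht ↦
      hasDerivAt_sqrt_div_log_cube (hmem t ht)
    have hgc : ContinuousOn (fun t : ℝ ↦ (2 * Real.log t - 12) / (Real.sqrt t * Real.log t ^ 4)) (uIcc a x) := by
      have hl : ContinuousOn Real.log (uIcc a x) :=
        Real.continuousOn_log.mono fun t ht ↦ by have := hmem t ht; simp; linarith
      refine ((continuousOn_const.mul hl).sub continuousOn_const).div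
        (Real.continuous_sqrt.continuousOn.mul (hl.pow 4)) fun t ht ↦ ?_
      have := hmem t ht
      exact mul_ne_zero (Real.sqrt_pos.2 (by linarith)).ne' (pow_ne_zero _ (Real.log_pos this).ne')
    have hFTC := intervalIntegral.integral_eq_sub_of_hasDerivAt hderiv hgc.intervalIntegrable
    have hcmp : ∫ t in a..x, 1 / (Real.sqrt t * Real.log t ^ 3) ≤
        ∫ t in a..x, (2 * Real.log t - 12) / (Real.sqrt t * Real.log t ^ 4) := by
      refine intervalIntegral.integral_mono_on hxa.le (hcont hx₀a hxa.le) hgc.intervalIntegrable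
        fun t ht ↦ ?_
      have ht1 : 1 < t := ha1.trans_le ht.1
      have ht0 : 0 < t := by linarith
      have hl12 : 12 ≤ Real.log t := by
        rw [Real.le_log_iff_exp_le ht0]; exact hea.trans ht.1
      have hl0 : 0 < Real.log t := by linarith
      have hs0 : 0 < Real.sqrt t := Real.sqrt_pos.2 ht0
      rw [div_le_div_iff₀ (by positivity) (by positivity)]
      have : Real.sqrt t * Real.log t ^ 4 = (Real.sqrt t * Real.log t ^ 3) * Real.log t := by ring
      rw [this]
      have h2 : Real.log t ≤ 2 * Real.log t - 12 := by linarith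
      calc 1 * (Real.sqrt t * Real.log t ^ 3 * Real.log t)
          = Real.log t * (Real.sqrt t * Real.log t ^ 3) := by ring
        _ ≤ (2 * Real.log t - 12) * (Real.sqrt t * Real.log t ^ 3) :=
            mul_le_mul_of_nonneg_right h2 (by positivity)
    have hga : 0 ≤ 4 * Real.sqrt a / Real.log a ^ 3 := by
      have := Real.log_pos ha1; positivity
    rw [hsplit]
    linarith [hcmp, hFTC]

/-- The constant collecting the `x₀`-terms of the `D`-bound. [folklore] -/
def dConst (x₀ : ℝ) : ℝ :=
  |robinF x₀| + lam3 * (Real.sqrt x₀ * uw x₀) +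
    Real.log (2 * π) * (1 / Real.log x₀ + 1 / Real.log x₀ ^ 2) +
    (|(psiOneRemainder x₀).re| + x₀ / (2 * (x₀ ^ 2 - 1))) * wt x₀

/-- **Robin's `D` under RH with the sharp leading constant** (`2 ≤ x₀ ≤ x`):
`|D(x)| ≤ λ √x/log²x + λ₃ (2√x/log³x + ∫_{x₀}^x √t|u'(t)| dt) + dConst x₀`, `λ = Σ m(ρ)/|ρ|² = nicolasBeta`.
[cite: Nicolas2017, (1.3) and Prop. 3.1; Robin1984Toulouse, §4 (13)–(16)] -/
theorem abs_robinD_le_sharp (hRH : RiemannHypothesis) {x₀ x : ℝ} (hx₀ : 2 ≤ x₀) (hx : x₀ ≤ x) :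
    |robinD x| ≤ nicolasBeta * (Real.sqrt x / Real.log x ^ 2) +
      lam3 * (2 * Real.sqrt x / Real.log x ^ 3 + ∫ t in x₀..x, Real.sqrt t * |uwDeriv t|) +
      dConst x₀ := by
  have hx₀1 : 1 < x₀ := by linarith
  have hx1 : 1 < x := by linarith
  have hx00 : 0 < x₀ := by linarith
  have hlx₀ : 0 < Real.log x₀ := Real.log_pos hx₀1
  have hlx : 0 < Real.log x := Real.log_pos hx1
  have hl0x : Real.log x₀ ≤ Real.log x := Real.log_le_log hx00 hx
  rw [robinD_eq_brackets hx₀ hx]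
  -- the zero bracket
  have hZ := norm_zeroBracket_le hRH hx₀1 hx
  have hZre := (Complex.abs_re_le_norm (Zsum x * (wt x : ℂ) - ∫ t in x₀..x, Zsum t * (wtDeriv t : ℂ))).trans hZ
  -- the linear bracket
  have hL : x * wt x - ∫ t in x₀..x, t * wtDeriv t =
      (1 / Real.log x₀ + 1 / Real.log x₀ ^ 2) - 1 / Real.log x := by
    rw [integral_id_mul_wtDeriv hx₀1 hx, wt]
    field_simp
    ring
  have hLabs : |x * wt x - ∫ t in x₀..x, t * wtDeriv t| ≤ 1 / Real.log x₀ + 1 / Real.log x₀ ^ 2 := by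
    rw [hL, abs_le]
    have h1 : 1 / Real.log x ≤ 1 / Real.log x₀ := div_le_div_of_nonneg_left zero_le_one hlx₀ hl0x
    have h2 : 0 < 1 / Real.log x := by positivity
    have h3 : 0 < 1 / Real.log x₀ ^ 2 := by positivity
    constructor <;> linarith
  have hlog2π : 0 < Real.log (2 * π) := Real.log_pos (by linarith [Real.pi_gt_three])
  -- the remainder bracket
  have hE := eBracket_mem hx₀1 hx
  have hEd := re_psiOneRemainder_sub_mem hx₀1 hx
  have hw0 : 0 ≤ wt x₀ := by
    have : 0 < x₀ * Real.log x₀ ^ 2 := by positivity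
    exact (inv_pos.2 this).le
  have hEabs : |(∫ t in x₀..x, (psiOneRemainder t).re * wtDeriv t) - (psiOneRemainder x).re * wt x| ≤
      (|(psiOneRemainder x₀).re| + x₀ / (2 * (x₀ ^ 2 - 1))) * wt x₀ := by
    rw [abs_le]
    have ha := neg_abs_le (psiOneRemainder x₀).re
    have hb := le_abs_self (psiOneRemainder x₀).re
    constructor
    · have : (psiOneRemainder x).re ≤ |(psiOneRemainder x₀).re| + x₀ / (2 * (x₀ ^ 2 - 1)) := by
        linarith [hEd.2]
      nlinarith [hE.1, mul_le_mul_of_nonneg_right this hw0]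
    · nlinarith [hE.2, mul_le_mul_of_nonneg_right ha hw0, hEd.1]
  -- assemble
  have hF := le_abs_self (robinF x₀)
  have hF' := neg_abs_le (robinF x₀)
  have hl3 := lam3_nonneg
  have htri := abs_add_three (robinF x₀ +
      (Zsum x * (wt x : ℂ) - ∫ t in x₀..x, Zsum t * (wtDeriv t : ℂ)).re)
    (Real.log (2 * π) * (x * wt x - ∫ t in x₀..x, t * wtDeriv t))
    ((∫ t in x₀..x, (psiOneRemainder t).re * wtDeriv t) - (psiOneRemainder x).re * wt x)
  have h12 := abs_add_le (robinF x₀) (Zsum x * (wt x : ℂ) - ∫ t in x₀..x, Zsum t * (wtDeriv t : ℂ)).re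
  rw [abs_mul, abs_of_pos hlog2π] at htri
  have hLm := mul_le_mul_of_nonneg_left hLabs hlog2π.le
  unfold dConst
  nlinarith [htri, h12, hZre, hLm, hEabs, Real.sqrt_nonneg x₀, uw_nonneg hx₀1]

/-- **Corollary**: under RH there are `C₀, C₁ ≥ 0` with
`|D(x)| ≤ λ √x/log² x + C₁ √x/log³ x + C₀` for all `x ≥ 2`. [cite: Nicolas2017, (1.3); Robin1984Toulouse, §4] -/
theorem exists_abs_robinD_le_of_RH (hRH : RiemannHypothesis) :
    ∃ C₀ C₁ : ℝ, 0 ≤ C₀ ∧ 0 ≤ C₁ ∧ ∀ x : ℝ, 2 ≤ x →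
      |robinD x| ≤ nicolasBeta * (Real.sqrt x / Real.log x ^ 2) +
        C₁ * (Real.sqrt x / Real.log x ^ 3) + C₀ := by
  set K₀ : ℝ := ∫ t in (2 : ℝ)..max 2 (Real.exp 12), 1 / (Real.sqrt t * Real.log t ^ 3) with hK₀
  have hK₀0 : 0 ≤ K₀ := by
    refine intervalIntegral.integral_nonneg (le_max_left _ _) fun t ht ↦ ?_
    have := Real.log_pos (by linarith [ht.1] : (1 : ℝ) < t); positivity
  have hl3 := lam3_nonneg
  set c : ℝ := 2 + 6 / Real.log 2 with hc
  have hc0 : 0 ≤ c := by have := Real.log_pos one_lt_two; positivity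
  have hd0 : 0 ≤ dConst 2 := by
    have h1 := Real.log_pos one_lt_two
    have h2 : 0 ≤ wt 2 := by
      have : (0 : ℝ) < 2 * Real.log 2 ^ 2 := by positivity
      exact (inv_pos.2 this).le
    have h3 : 0 < Real.log (2 * π) := Real.log_pos (by linarith [Real.pi_gt_three])
    unfold dConst
    have := uw_nonneg one_lt_two
    positivity
  refine ⟨dConst 2 + lam3 * (c * K₀), lam3 * (2 + 4 * c), by positivity, by positivity, fun x hx ↦ ?_⟩
  have h := abs_robinD_le_sharp hRH le_rfl hx
  have hI := (integral_sqrt_mul_abs_uwDeriv_le one_lt_two hx).trans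
    (mul_le_mul_of_nonneg_left (integral_inv_sqrt_log_cube_le one_lt_two hx) hc0)
  rw [← hK₀, ← hc] at hI
  have hs : 0 ≤ Real.sqrt x / Real.log x ^ 3 := by
    have := Real.log_pos (by linarith : (1 : ℝ) < x); positivity
  set sx : ℝ := Real.sqrt x / Real.log x ^ 3 with hsx
  have e1 : 2 * Real.sqrt x / Real.log x ^ 3 = 2 * sx := by rw [hsx]; ring
  have e2 : 4 * Real.sqrt x / Real.log x ^ 3 = 4 * sx := by rw [hsx]; ring
  rw [e1] at h
  rw [e2] at hI
  have key : lam3 * (2 * sx + ∫ t in (2 : ℝ)..x, Real.sqrt t * |uwDeriv t|) ≤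
      lam3 * (2 + 4 * c) * sx + lam3 * (c * K₀) := by
    have : 2 * sx + ∫ t in (2 : ℝ)..x, Real.sqrt t * |uwDeriv t| ≤ (2 + 4 * c) * sx + c * K₀ := by
      nlinarith [hI]
    nlinarith [mul_le_mul_of_nonneg_left this hl3]
  linarith


/-! ### §6. The prime-power part `P(x) = ∑_{k ≥ 2} B(x^{1/k})/k`, `B(y) = π(y) − θ(y)/log y` -/

/-- Nicolas's `B(y) = π(y) − θ(y)/log y = ∑_{p ≤ y} (1 − log p/log y)` (non-negative, non-decreasing).
[cite: Nicolas2017, §3.2] -/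
def nicolasB (y : ℝ) : ℝ := (Nat.primeCounting ⌊y⌋₊ : ℝ) - θ y / Real.log y

/-- `B(y) ≥ 0` for `y ≥ 1` (`θ(y) ≤ π(y) log y`). [cite: Nicolas2017, §3.2] -/
theorem nicolasB_nonneg {y : ℝ} (hy : 1 ≤ y) : 0 ≤ nicolasB y := by
  rcases hy.eq_or_lt with h | h
  · rw [nicolasB, ← h]; simp
  · have hl : 0 < Real.log y := Real.log_pos h
    have := Chebyshev.theta_le_pi_mul_log' y
    rw [nicolasB, sub_nonneg, div_le_iff₀ hl]
    exact this

/-- `B(y) ≤ π(y) ≤ y` for `y ≥ 1`. [cite: Nicolas2017, §3.2] -/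
theorem nicolasB_le {y : ℝ} (hy : 1 ≤ y) : nicolasB y ≤ y := by
  have hθ : 0 ≤ θ y / Real.log y := div_nonneg (Chebyshev.theta_nonneg y) (Real.log_nonneg hy)
  have h1 := PiOmega.primePowerPi_le (by linarith : (0 : ℝ) ≤ y)
  have h2 := PiOmega.primePowerPi_sub_primeCounting_nonneg y
  rw [nicolasB]
  linarith

/-- At a prime power: `g(p^k) = 1/k − log p/log x` for `k ≥ 2`, and `g(p) = 0`. [cite: Robin1984Toulouse, §4 (13)] -/
theorem gTerm_prime_pow {x : ℝ} {p k : ℕ} (hp : p.Prime) (hk : 1 ≤ k) :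
    gTerm x (p ^ k) = if k = 1 then 0 else 1 / k - Real.log p / Real.log x := by
  have hk0 : k ≠ 0 := by omega
  have hlp : 0 < Real.log p := Real.log_pos (by exact_mod_cast hp.one_lt)
  rw [gTerm, ArithmeticFunction.vonMangoldt_apply_pow hk0, ArithmeticFunction.vonMangoldt_apply_prime hp]
  push_cast
  rw [Real.log_pow]
  by_cases h1 : k = 1
  · subst h1
    have hp1 : (p ^ 1).Prime := by simpa using hp
    rw [if_pos hp1, if_pos rfl]
    simp [hlp.ne']
  · have hnp : ¬ (p ^ k).Prime := fun h ↦ h1 (Nat.Prime.eq_one_of_pow h)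
    rw [if_neg hnp, if_neg h1]
    have hk' : (k : ℝ) ≠ 0 := by exact_mod_cast hk0
    field_simp
    ring

/-- **`P(x) = ∑_{2 ≤ k ≤ log x/log 2} B(x^{1/k})/k`** (`x ≥ 2`): regroup the prime powers by exponent
(Mathlib's `Chebyshev.sum_PrimePow_eq_sum_sum`). [cite: Nicolas2017, Prop. 3.2 (3.14)] -/
theorem posPart_eq_sum_nicolasB {x : ℝ} (hx : 2 ≤ x) :
    LiThetaRH.posPart x = ∑ k ∈ Finset.Icc 2 ⌊Real.log x / Real.log 2⌋₊, nicolasB (x ^ ((1 : ℝ) / k)) / k := by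
  have hx0 : 0 ≤ x := by linarith
  have hxpos : 0 < x := by linarith
  have hlx : 0 < Real.log x := Real.log_pos (by linarith)
  rw [posPart_eq_sum]
  -- only prime powers contribute
  have h1 : ∑ n ∈ Finset.Ioc 0 ⌊x⌋₊, gTerm x n = ∑ n ∈ Finset.Ioc 0 ⌊x⌋₊ with IsPrimePow n, gTerm x n := by
    rw [Finset.sum_filter]
    refine Finset.sum_congr rfl fun n _ ↦ ?_
    split_ifs with h
    · rfl
    · have hΛ : (ArithmeticFunction.vonMangoldt n : ℝ) = 0 := ArithmeticFunction.vonMangoldt_eq_zero_iff.2 h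
      have hnp : ¬ n.Prime := fun hp ↦ h hp.isPrimePow
      rw [gTerm, hΛ, if_neg hnp]; ring
  rw [h1, Chebyshev.sum_PrimePow_eq_sum_sum _ hx0]
  -- the exponent `k = 1` contributes nothing; split it off
  have hκ : 1 ≤ ⌊Real.log x / Real.log 2⌋₊ := by
    rw [Nat.one_le_floor_iff, le_div_iff₀ (Real.log_pos one_lt_two), one_mul]
    exact Real.log_le_log two_pos hx
  rw [← Finset.add_sum_Ioc_eq_sum_Icc hκ]
  have hk1 : ∑ p ∈ Finset.Ioc 0 ⌊x ^ ((1 : ℝ) / (1 : ℕ))⌋₊ with p.Prime, gTerm x (p ^ 1) = 0 := by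
    refine Finset.sum_eq_zero fun p hp ↦ ?_
    rw [Finset.mem_filter] at hp
    rw [gTerm_prime_pow hp.2 le_rfl, if_pos rfl]
  rw [hk1, zero_add]
  refine Finset.sum_congr (by ext k; simp only [Finset.mem_Ioc, Finset.mem_Icc]; omega) fun k hk ↦ ?_
  rw [Finset.mem_Icc] at hk
  have hk2 : 2 ≤ k := hk.1
  have hkpos : (0 : ℝ) < k := by exact_mod_cast (by omega : 0 < k)
  set y : ℝ := x ^ ((1 : ℝ) / k) with hy
  have hy1 : 1 < y := Real.one_lt_rpow (by linarith) (by positivity)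
  have hlogy : Real.log y = Real.log x / k := by
    rw [hy, Real.log_rpow hxpos]; ring
  have hly : 0 < Real.log y := Real.log_pos hy1
  -- inner sum
  have hinner : ∑ p ∈ Finset.Ioc 0 ⌊y⌋₊ with p.Prime, gTerm x (p ^ k) =
      ∑ p ∈ Finset.Ioc 0 ⌊y⌋₊ with p.Prime, ((1 : ℝ) / k - Real.log p / Real.log x) := by
    refine Finset.sum_congr rfl fun p hp ↦ ?_
    rw [Finset.mem_filter] at hp
    rw [gTerm_prime_pow hp.2 (by omega), if_neg (by omega)]
  rw [hinner, Finset.sum_sub_distrib, Finset.sum_const, nsmul_eq_mul, ← Finset.sum_div]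
  have hcard : ((Finset.Ioc 0 ⌊y⌋₊).filter Nat.Prime).card = Nat.primeCounting ⌊y⌋₊ := by
    have hset : (Finset.Ioc 0 ⌊y⌋₊).filter Nat.Prime = Nat.primesLE ⌊y⌋₊ := by
      ext p
      simp only [Finset.mem_filter, Finset.mem_Ioc, Nat.mem_primesLE]
      constructor
      · rintro ⟨⟨-, h2⟩, hp⟩; exact ⟨h2, hp⟩
      · rintro ⟨h1, hp⟩; exact ⟨⟨hp.pos, h1⟩, hp⟩
    rw [hset, Nat.primesLE_card_eq_primeCounting]
  have hθ : ∑ p ∈ Finset.Ioc 0 ⌊y⌋₊ with p.Prime, Real.log p = θ y := by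
    rw [Chebyshev.theta]
  rw [hcard, hθ, nicolasB, hlogy]
  field_simp

/-- **`B(√x)/2 ≤ P(x) ≤ B(√x)/2 + (log x/log 2) x^{1/3}`** (`x ≥ 4`): the `k = 2` term is the main
term, the `k ≥ 3` terms are each `≤ x^{1/3}` and there are `≤ log x/log 2` of them. [cite: Nicolas2017, Lemma 3.4 (proof)] -/
theorem posPart_bounds {x : ℝ} (hx : 4 ≤ x) :
    nicolasB (Real.sqrt x) / 2 ≤ LiThetaRH.posPart x ∧
      LiThetaRH.posPart x ≤ nicolasB (Real.sqrt x) / 2 + Real.log x / Real.log 2 * x ^ ((1 : ℝ) / 3) := by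
  have hxpos : 0 < x := by linarith
  have hx1 : 1 ≤ x := by linarith
  rw [posPart_eq_sum_nicolasB (by linarith)]
  set κ := ⌊Real.log x / Real.log 2⌋₊ with hκ
  have hl2 : 0 < Real.log 2 := Real.log_pos one_lt_two
  have hκ2 : 2 ≤ κ := by
    rw [hκ, Nat.le_floor_iff (div_nonneg (Real.log_nonneg hx1) hl2.le), le_div_iff₀ hl2]
    have : Real.log 4 = 2 * Real.log 2 := by
      rw [show (4 : ℝ) = 2 ^ 2 by norm_num, Real.log_pow]; norm_num
    push_cast
    rw [← this]
    exact Real.log_le_log (by norm_num) hx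
  have hκle : (κ : ℝ) ≤ Real.log x / Real.log 2 := Nat.floor_le (div_nonneg (Real.log_nonneg hx1) hl2.le)
  rw [← Finset.add_sum_Ioc_eq_sum_Icc hκ2]
  have hsq : x ^ ((1 : ℝ) / (2 : ℕ)) = Real.sqrt x := by
    rw [Real.sqrt_eq_rpow]; norm_num
  rw [hsq]
  -- the tail
  have hterm : ∀ k ∈ Finset.Ioc 2 κ, 0 ≤ nicolasB (x ^ ((1 : ℝ) / k)) / k ∧
      nicolasB (x ^ ((1 : ℝ) / k)) / k ≤ x ^ ((1 : ℝ) / 3) := by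
    intro k hk
    rw [Finset.mem_Ioc] at hk
    have hk3 : (3 : ℝ) ≤ k := by exact_mod_cast hk.1
    have hy1 : 1 ≤ x ^ ((1 : ℝ) / k) := Real.one_le_rpow hx1 (by positivity)
    refine ⟨div_nonneg (nicolasB_nonneg hy1) (by positivity), ?_⟩
    calc nicolasB (x ^ ((1 : ℝ) / k)) / k ≤ nicolasB (x ^ ((1 : ℝ) / k)) / 1 :=
          div_le_div_of_nonneg_left (nicolasB_nonneg hy1) one_pos (by linarith)
      _ ≤ x ^ ((1 : ℝ) / k) := by rw [div_one]; exact nicolasB_le hy1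
      _ ≤ x ^ ((1 : ℝ) / 3) := by
          refine Real.rpow_le_rpow_of_exponent_le hx1 ?_
          exact div_le_div_of_nonneg_left zero_le_one (by norm_num) hk3
  have htail0 : 0 ≤ ∑ k ∈ Finset.Ioc 2 κ, nicolasB (x ^ ((1 : ℝ) / k)) / k :=
    Finset.sum_nonneg fun k hk ↦ (hterm k hk).1
  have htail : ∑ k ∈ Finset.Ioc 2 κ, nicolasB (x ^ ((1 : ℝ) / k)) / k ≤
      Real.log x / Real.log 2 * x ^ ((1 : ℝ) / 3) := by
    calc ∑ k ∈ Finset.Ioc 2 κ, nicolasB (x ^ ((1 : ℝ) / k)) / k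
        ≤ ∑ k ∈ Finset.Ioc 2 κ, x ^ ((1 : ℝ) / 3) := Finset.sum_le_sum fun k hk ↦ (hterm k hk).2
      _ = ((κ : ℝ) - 2) * x ^ ((1 : ℝ) / 3) := by
          rw [Finset.sum_const, nsmul_eq_mul, Nat.card_Ioc]
          push_cast [hκ2]
          ring
      _ ≤ Real.log x / Real.log 2 * x ^ ((1 : ℝ) / 3) :=
          mul_le_mul_of_nonneg_right (by linarith) (Real.rpow_nonneg hxpos.le _)
  push_cast
  constructor <;> linarith

/-! ### §7. `B(y) ∼ y/log² y` under RH, hence `P(x) log² x/√x → 2` -/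

/-- `li(y) − y/log y − y/log² y = 2 Li₃(y) + (li 2 − 2/log 2 − 2/log² 2)` for `y > 1`
(two integrations by parts). [cite: Nicolas2017, (2.6)–(2.7)] -/
theorem logIntegral_sub_two_terms {y : ℝ} (hy : 1 < y) :
    logIntegral y - y / Real.log y - y / Real.log y ^ 2 =
      2 * offsetLogIntegralPow 3 y + (logIntegral 2 - 2 / Real.log 2 - 2 / Real.log 2 ^ 2) := by
  have h0 := logIntegral_eq_offsetLogIntegral_add_logIntegral_two hy
  have h1 := offsetLogIntegralPow_integration_by_parts 1 hy
  have h2 := offsetLogIntegralPow_integration_by_parts 2 hy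
  rw [← offsetLogIntegralPow_one] at h0
  simp only [Nat.cast_one, one_mul, pow_one, Nat.cast_ofNat] at h1 h2
  rw [h0, h1, h2]
  simp only [inv_pow, div_eq_mul_inv]
  ring

/-- `Li₃(y) = O(y/log³ y)`. [folklore] -/
private theorem isBigO_offsetLogIntegralPow_three :
    offsetLogIntegralPow 3 =O[atTop] fun y ↦ y / Real.log y ^ 3 :=
  (isEquivalent_offsetLogIntegralPow_holds 3).isBigO

/-- `y/log³ y = o(y/log² y)`. [folklore] -/
private theorem isLittleO_div_log_cube : (fun y : ℝ ↦ y / Real.log y ^ 3) =o[atTop] fun y ↦ y / Real.log y ^ 2 := by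
  have h1 : (fun y : ℝ ↦ (Real.log y)⁻¹) =o[atTop] fun _ ↦ (1 : ℝ) := by
    rw [Asymptotics.isLittleO_one_iff]
    exact tendsto_inv_atTop_zero.comp Real.tendsto_log_atTop
  have h2 := h1.mul_isBigO (Asymptotics.isBigO_refl (fun y : ℝ ↦ y / Real.log y ^ 2) atTop)
  refine (h2.congr' ?_ ?_)
  · filter_upwards [eventually_gt_atTop 1] with y hy
    have hl : Real.log y ≠ 0 := (Real.log_pos hy).ne'
    field_simp
  · exact Filter.Eventually.of_forall fun y ↦ by simp

/-- `√y log y = o(y/log² y)` (`log³ y = o(√y)`). [folklore] -/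
private theorem isLittleO_sqrt_mul_log : (fun y : ℝ ↦ Real.sqrt y * Real.log y) =o[atTop] fun y ↦ y / Real.log y ^ 2 := by
  have h1 : (fun y : ℝ ↦ Real.log y ^ (3 : ℝ)) =o[atTop] fun y ↦ y ^ (1 / 2 : ℝ) :=
    isLittleO_log_rpow_rpow_atTop 3 (by norm_num)
  have h2 := h1.mul_isBigO (Asymptotics.isBigO_refl (fun y : ℝ ↦ Real.sqrt y / Real.log y ^ 2) atTop)
  refine h2.congr' ?_ ?_
  · filter_upwards [eventually_gt_atTop 1] with y hy
    have hl : Real.log y ≠ 0 := (Real.log_pos hy).ne'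
    rw [show (3 : ℝ) = (3 : ℕ) by norm_num, Real.rpow_natCast]
    field_simp
  · filter_upwards [eventually_gt_atTop 1] with y hy
    have hl : Real.log y ≠ 0 := (Real.log_pos hy).ne'
    rw [← Real.sqrt_eq_rpow]
    field_simp
    rw [Real.sq_sqrt (by linarith)]

/-- Constants are `o(y/log² y)` (`y/log² y → ∞`). [folklore] -/
private theorem isLittleO_const_div_log_sq : (fun _ : ℝ ↦ (1 : ℝ)) =o[atTop] fun y ↦ y / Real.log y ^ 2 := by
  refine Asymptotics.isLittleO_const_left.2 (Or.inr ?_)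
  have h := tendsto_self_mul_inv_log_pow_atTop 2
  refine (tendsto_norm_atTop_atTop.comp h).congr' ?_
  exact Filter.Eventually.of_forall fun y ↦ by simp [div_eq_mul_inv]

/-- **`B(y) ∼ y/log² y` under RH** (`π = li + O(√y log y)`, `θ = y + O(√y log² y)`,
`li = y/log y + y/log² y + O(y/log³ y)`). [cite: Nicolas2017, Lemma 3.3 (3.7)–(3.8) and (2.13)] -/
theorem isEquivalent_nicolasB (hRH : RiemannHypothesis) :
    Asymptotics.IsEquivalent atTop nicolasB fun y ↦ y / Real.log y ^ 2 := by
  have hπ := primeCounting_sub_logIntegral_isBigO_of_riemannHypothesis hRH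
  have hθ : (fun y : ℝ ↦ θ y - y) =O[atTop] fun y ↦ y ^ (1 / 2 : ℝ) * Real.log y ^ 2 :=
    riemannHypothesis_iff_chebyshevTheta_isBigO_holds.mp hRH
  -- the three error terms are `o(y/log² y)`
  have e1 : (fun y : ℝ ↦ (Nat.primeCounting ⌊y⌋₊ : ℝ) - logIntegral y) =o[atTop] fun y ↦ y / Real.log y ^ 2 :=
    hπ.trans_isLittleO isLittleO_sqrt_mul_log
  have e2 : (fun y : ℝ ↦ logIntegral y - y / Real.log y - y / Real.log y ^ 2) =o[atTop]
      fun y ↦ y / Real.log y ^ 2 := by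
    have h3 : (fun y : ℝ ↦ 2 * offsetLogIntegralPow 3 y) =o[atTop] fun y ↦ y / Real.log y ^ 2 :=
      (isBigO_offsetLogIntegralPow_three.const_mul_left 2).trans_isLittleO isLittleO_div_log_cube
    have h4 : (fun _ : ℝ ↦ logIntegral 2 - 2 / Real.log 2 - 2 / Real.log 2 ^ 2) =o[atTop]
        fun y ↦ y / Real.log y ^ 2 :=
      (isLittleO_const_div_log_sq.const_mul_left (logIntegral 2 - 2 / Real.log 2 - 2 / Real.log 2 ^ 2)).congr_left
        fun _ ↦ mul_one _
    refine (h3.add h4).congr' ?_ (Filter.Eventually.of_forall fun _ ↦ rfl)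
    filter_upwards [eventually_gt_atTop 1] with y hy
    exact (logIntegral_sub_two_terms hy).symm
  have e3 : (fun y : ℝ ↦ (θ y - y) / Real.log y) =o[atTop] fun y ↦ y / Real.log y ^ 2 := by
    have h5 : (fun y : ℝ ↦ (θ y - y) / Real.log y) =O[atTop] fun y ↦ Real.sqrt y * Real.log y := by
      refine (hθ.mul (Asymptotics.isBigO_refl (fun y : ℝ ↦ (Real.log y)⁻¹) atTop)).congr' ?_ ?_
      · exact Filter.Eventually.of_forall fun y ↦ by simp [div_eq_mul_inv]
      · filter_upwards [eventually_gt_atTop 1] with y hy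
        have hl : Real.log y ≠ 0 := (Real.log_pos hy).ne'
        rw [← Real.sqrt_eq_rpow]
        field_simp
    exact h5.trans_isLittleO isLittleO_sqrt_mul_log
  have hsum := (e1.add e2).sub e3
  refine (hsum.congr' ?_ (Filter.Eventually.of_forall fun _ ↦ rfl))
  filter_upwards [eventually_gt_atTop 1] with y hy
  have hl : Real.log y ≠ 0 := (Real.log_pos hy).ne'
  simp only [nicolasB, Pi.sub_apply]
  field_simp
  ring

/-- **`B(y) log² y / y → 1` under RH.** [cite: Nicolas2017, Lemma 3.3] -/
theorem tendsto_nicolasB_ratio (hRH : RiemannHypothesis) :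
    Tendsto (fun y : ℝ ↦ nicolasB y * Real.log y ^ 2 / y) atTop (𝓝 1) := by
  have h := isEquivalent_nicolasB hRH
  have hz : ∀ᶠ y : ℝ in atTop, y / Real.log y ^ 2 ≠ 0 := by
    filter_upwards [eventually_gt_atTop 1] with y hy
    have := Real.log_pos hy; positivity
  have ht := (Asymptotics.isEquivalent_iff_tendsto_one hz).1 h
  refine ht.congr' ?_
  filter_upwards [eventually_gt_atTop 1] with y hy
  have hl : Real.log y ≠ 0 := (Real.log_pos hy).ne'
  have hy0 : y ≠ 0 := by linarith
  show nicolasB y / (y / Real.log y ^ 2) = _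
  field_simp

/-- **`P(x) log² x/√x → 2` under RH.** [cite: Nicolas2017, Lemma 3.4 and Prop. 3.3 (the `2√x/log² x` term)] -/
theorem tendsto_posPart_ratio (hRH : RiemannHypothesis) :
    Tendsto (fun x : ℝ ↦ LiThetaRH.posPart x * Real.log x ^ 2 / Real.sqrt x) atTop (𝓝 2) := by
  -- main term: `B(√x) log² x/(2√x) = 2 · (B(√x) log²(√x)/√x) → 2`
  have hB := (tendsto_nicolasB_ratio hRH).comp Real.tendsto_sqrt_atTop
  have hmain : Tendsto (fun x : ℝ ↦ nicolasB (Real.sqrt x) / 2 * Real.log x ^ 2 / Real.sqrt x) atTop (𝓝 2) := by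
    have h2 := hB.const_mul 2
    rw [mul_one] at h2
    refine h2.congr' ?_
    filter_upwards [eventually_gt_atTop 1] with x hx
    have hx0 : 0 < x := by linarith
    simp only [Function.comp_apply]
    rw [Real.log_sqrt hx0.le]
    ring
  -- error term: `(log x/log 2) x^{1/3} log² x/√x → 0`
  have herr : Tendsto (fun x : ℝ ↦ Real.log x / Real.log 2 * x ^ ((1 : ℝ) / 3) * Real.log x ^ 2 / Real.sqrt x)
      atTop (𝓝 0) := by
    have h1 : (fun x : ℝ ↦ Real.log x ^ (3 : ℝ)) =o[atTop] fun x ↦ x ^ (1 / 6 : ℝ) :=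
      isLittleO_log_rpow_rpow_atTop 3 (by norm_num)
    have h2 := h1.tendsto_div_nhds_zero.const_mul (1 / Real.log 2)
    rw [mul_zero] at h2
    refine h2.congr' ?_
    filter_upwards [eventually_gt_atTop 1] with x hx
    have hx0 : 0 < x := by linarith
    have hl2 : Real.log 2 ≠ 0 := (Real.log_pos one_lt_two).ne'
    rw [show (3 : ℝ) = (3 : ℕ) by norm_num, Real.rpow_natCast, Real.sqrt_eq_rpow,
      show x ^ (1 / 2 : ℝ) = x ^ (1 / 6 : ℝ) * x ^ ((1 : ℝ) / 3) by
        rw [← Real.rpow_add hx0]; norm_num]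
    have h6 : 0 < x ^ (1 / 6 : ℝ) := Real.rpow_pos_of_pos hx0 _
    have h3 : 0 < x ^ ((1 : ℝ) / 3) := Real.rpow_pos_of_pos hx0 _
    field_simp
    norm_num
  have hupper : Tendsto (fun x : ℝ ↦ nicolasB (Real.sqrt x) / 2 * Real.log x ^ 2 / Real.sqrt x +
      Real.log x / Real.log 2 * x ^ ((1 : ℝ) / 3) * Real.log x ^ 2 / Real.sqrt x) atTop (𝓝 2) := by
    have := hmain.add herr
    rw [add_zero] at this
    exact this
  refine tendsto_of_tendsto_of_tendsto_of_le_of_le' hmain hupper ?_ ?_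
  · filter_upwards [eventually_ge_atTop 4] with x hx
    have hb := (posPart_bounds hx).1
    have hs : 0 < Real.sqrt x := Real.sqrt_pos.2 (by linarith)
    have hl : 0 ≤ Real.log x ^ 2 := sq_nonneg _
    exact div_le_div_of_nonneg_right (mul_le_mul_of_nonneg_right hb hl) hs.le
  · filter_upwards [eventually_ge_atTop 4] with x hx
    have hb := (posPart_bounds hx).2
    have hs : 0 < Real.sqrt x := Real.sqrt_pos.2 (by linarith)
    have hl : 0 ≤ Real.log x ^ 2 := sq_nonneg _
    have := div_le_div_of_nonneg_right (mul_le_mul_of_nonneg_right hb hl) hs.le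
    refine this.trans_eq ?_
    ring


/-! ### §8. Assembly: Nicolas 2017, Thm. 1.1 (1.6)–(1.7) under RH -/

/-- `log^n x/√x → 0`. [folklore] -/
private theorem tendsto_log_pow_div_sqrt (n : ℕ) :
    Tendsto (fun x : ℝ ↦ Real.log x ^ n / Real.sqrt x) atTop (𝓝 0) := by
  have h := (isLittleO_log_rpow_rpow_atTop (n : ℝ) (by norm_num : (0 : ℝ) < 1 / 2)).tendsto_div_nhds_zero
  refine h.congr' (Filter.Eventually.of_forall fun x ↦ ?_)
  show Real.log x ^ (n : ℝ) / x ^ (1 / 2 : ℝ) = Real.log x ^ n / Real.sqrt x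
  rw [Real.rpow_natCast, Real.sqrt_eq_rpow]

/-- Under RH, for every `ε > 0`: eventually `|D(x)| log² x/√x ≤ λ + ε`. [cite: Nicolas2017, (1.3)] -/
theorem eventually_abs_robinD_ratio_le (hRH : RiemannHypothesis) {ε : ℝ} (hε : 0 < ε) :
    ∀ᶠ x : ℝ in atTop, |robinD x| * (Real.log x ^ 2 / Real.sqrt x) ≤ nicolasBeta + ε := by
  obtain ⟨C₀, C₁, hC₀, hC₁, hD⟩ := exists_abs_robinD_le_of_RH hRH
  have t1 : Tendsto (fun x : ℝ ↦ C₁ / Real.log x + C₀ * (Real.log x ^ 2 / Real.sqrt x)) atTop (𝓝 0) := by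
    have h1 : Tendsto (fun x : ℝ ↦ C₁ / Real.log x) atTop (𝓝 0) :=
      tendsto_const_nhds.div_atTop Real.tendsto_log_atTop
    have h2 := (tendsto_log_pow_div_sqrt 2).const_mul C₀
    rw [mul_zero] at h2
    simpa using h1.add h2
  filter_upwards [eventually_ge_atTop 2, (tendsto_order.1 t1).2 ε hε] with x hx hlt
  have hx1 : 1 < x := by linarith
  have hlx : 0 < Real.log x := Real.log_pos hx1
  have hsx : 0 < Real.sqrt x := Real.sqrt_pos.2 (by linarith)
  have hr : 0 ≤ Real.log x ^ 2 / Real.sqrt x := by positivity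
  have h := mul_le_mul_of_nonneg_right (hD x hx) hr
  have e : (nicolasBeta * (Real.sqrt x / Real.log x ^ 2) + C₁ * (Real.sqrt x / Real.log x ^ 3) + C₀) *
      (Real.log x ^ 2 / Real.sqrt x) = nicolasBeta + (C₁ / Real.log x + C₀ * (Real.log x ^ 2 / Real.sqrt x)) := by
    field_simp
    ring
  rw [e] at h
  linarith

/-- Under RH: a von Koch constant `K` for `θ`, with eventually `θ(x) > 1`, the hypotheses of
`gap_le_of_theta`, and the resulting `0 ≤ gap(x) ≤ 8K² log² x`. [cite: Robin1984Toulouse, §4 (13); Koch1901, Théorème] -/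
theorem eventually_gap_bounds (hRH : RiemannHypothesis) :
    ∃ K : ℝ, 0 < K ∧ ∀ᶠ x : ℝ in atTop, 1 < θ x ∧
      0 ≤ (θ x - x) / Real.log x - (logIntegral (θ x) - logIntegral x) ∧
      (θ x - x) / Real.log x - (logIntegral (θ x) - logIntegral x) ≤ 8 * K ^ 2 * Real.log x ^ 2 := by
  obtain ⟨K, X, hK, hX, hθ⟩ := exists_abs_theta_sub_le_of_RH hRH
  refine ⟨K, hK, ?_⟩
  have t := (tendsto_log_pow_div_sqrt 2).const_mul (2 * K)
  rw [mul_zero] at t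
  filter_upwards [eventually_ge_atTop X, eventually_ge_atTop 4, (tendsto_order.1 t).2 1 one_pos]
    with x hxX hx4 hsmall
  have hx0 : 0 < x := by linarith
  have hsx : 0 < Real.sqrt x := Real.sqrt_pos.2 hx0
  -- `2K√x log²x ≤ x`
  have hsm : 2 * K * Real.sqrt x * Real.log x ^ 2 ≤ x := by
    have h1 : 2 * K * (Real.log x ^ 2 / Real.sqrt x) * Real.sqrt x ≤ 1 * Real.sqrt x :=
      mul_le_mul_of_nonneg_right hsmall.le hsx.le
    have e1 : 2 * K * (Real.log x ^ 2 / Real.sqrt x) * Real.sqrt x = 2 * K * Real.log x ^ 2 := by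
      field_simp
    rw [e1, one_mul] at h1
    calc 2 * K * Real.sqrt x * Real.log x ^ 2 = (2 * K * Real.log x ^ 2) * Real.sqrt x := by ring
      _ ≤ Real.sqrt x * Real.sqrt x := mul_le_mul_of_nonneg_right h1 hsx.le
      _ = x := Real.mul_self_sqrt hx0.le
  have hθ1 : 1 < θ x := by
    have h := (abs_le.1 (hθ x hxX)).1
    have : K * Real.sqrt x * Real.log x ^ 2 ≤ x / 2 := by linarith
    linarith
  exact ⟨hθ1, gap_nonneg (by linarith) hθ1, gap_le_of_theta hθ hxX hx4 hsm⟩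

/-- **Nicolas 2017, Thm. 1.1 (1.6)** under RH: `lim sup A(x) log² x/√x ≤ 2 + λ`, in `ε`-form.
[cite: Nicolas2017, Thm. 1.1 (1.6); Cor. 3.2] -/
theorem limsup_le (hRH : RiemannHypothesis) {ε : ℝ} (hε : 0 < ε) :
    ∀ᶠ x : ℝ in atTop, liThetaSubPi x * Real.log x ^ 2 / Real.sqrt x ≤ 2 + nicolasBeta + ε := by
  have hε3 : 0 < ε / 3 := by linarith
  have hP := (tendsto_order.1 (tendsto_posPart_ratio hRH)).2 (2 + ε / 3) (by linarith)
  have hD := eventually_abs_robinD_ratio_le hRH hε3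
  have hli0 := (tendsto_log_pow_div_sqrt 2).const_mul (logIntegral 2)
  rw [mul_zero] at hli0
  have hli := (tendsto_order.1 hli0).2 (ε / 3) hε3
  obtain ⟨K, hK, hgap⟩ := eventually_gap_bounds hRH
  filter_upwards [hP, hD, hli, hgap, eventually_ge_atTop 2] with x hP hD hli hgap hx2
  have hx0 : 0 < x := by linarith
  have hr : 0 ≤ Real.log x ^ 2 / Real.sqrt x := by
    have := Real.log_pos (by linarith : (1 : ℝ) < x); positivity
  rw [liThetaSubPi_eq_posPart hx2]
  set r : ℝ := Real.log x ^ 2 / Real.sqrt x with hr'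
  have eP : LiThetaRH.posPart x * Real.log x ^ 2 / Real.sqrt x = LiThetaRH.posPart x * r := by
    rw [hr']; ring
  rw [eP] at hP
  have hDr : robinD x * r ≤ nicolasBeta + ε / 3 := (mul_le_mul_of_nonneg_right (le_abs_self _) hr).trans hD
  have hg : 0 ≤ ((θ x - x) / Real.log x - (logIntegral (θ x) - logIntegral x)) * r :=
    mul_nonneg hgap.2.1 hr
  have e : (robinD x + logIntegral 2 + LiThetaRH.posPart x -
      ((θ x - x) / Real.log x - (logIntegral (θ x) - logIntegral x))) * Real.log x ^ 2 / Real.sqrt x =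
      robinD x * r + logIntegral 2 * r + LiThetaRH.posPart x * r -
        ((θ x - x) / Real.log x - (logIntegral (θ x) - logIntegral x)) * r := by
    rw [hr']; ring
  rw [e]
  linarith

/-- **Nicolas 2017, Thm. 1.1 (1.7)** under RH: `lim inf A(x) log² x/√x ≥ 2 − λ`, in `ε`-form.
[cite: Nicolas2017, Thm. 1.1 (1.7); Cor. 3.1] -/
theorem le_liminf (hRH : RiemannHypothesis) {ε : ℝ} (hε : 0 < ε) :
    ∀ᶠ x : ℝ in atTop, 2 - nicolasBeta - ε ≤ liThetaSubPi x * Real.log x ^ 2 / Real.sqrt x := by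
  have hε3 : 0 < ε / 3 := by linarith
  have hP := (tendsto_order.1 (tendsto_posPart_ratio hRH)).1 (2 - ε / 3) (by linarith)
  have hD := eventually_abs_robinD_ratio_le hRH hε3
  obtain ⟨K, hK, hgap⟩ := eventually_gap_bounds hRH
  have hg0 := (tendsto_log_pow_div_sqrt 4).const_mul (8 * K ^ 2)
  rw [mul_zero] at hg0
  have hg4 := (tendsto_order.1 hg0).2 (ε / 3) hε3
  have hli2 : 0 < logIntegral 2 := logIntegral_two_pos_holds
  filter_upwards [hP, hD, hg4, hgap, eventually_ge_atTop 2] with x hP hD hg4 hgap hx2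
  have hx0 : 0 < x := by linarith
  have hsx : 0 < Real.sqrt x := Real.sqrt_pos.2 hx0
  have hr : 0 ≤ Real.log x ^ 2 / Real.sqrt x := by
    have := Real.log_pos (by linarith : (1 : ℝ) < x); positivity
  rw [liThetaSubPi_eq_posPart hx2]
  set r : ℝ := Real.log x ^ 2 / Real.sqrt x with hr'
  have eP : LiThetaRH.posPart x * Real.log x ^ 2 / Real.sqrt x = LiThetaRH.posPart x * r := by
    rw [hr']; ring
  rw [eP] at hP
  have hDr : -(nicolasBeta + ε / 3) ≤ robinD x * r := by
    have := (mul_le_mul_of_nonneg_right (neg_abs_le (robinD x)) hr)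
    linarith
  have hg : ((θ x - x) / Real.log x - (logIntegral (θ x) - logIntegral x)) * r ≤ ε / 3 := by
    have h1 := mul_le_mul_of_nonneg_right hgap.2.2 hr
    have e1 : 8 * K ^ 2 * Real.log x ^ 2 * r = 8 * K ^ 2 * (Real.log x ^ 4 / Real.sqrt x) := by
      rw [hr']; field_simp
    rw [e1] at h1
    linarith
  have hl : 0 ≤ logIntegral 2 * r := mul_nonneg hli2.le hr
  have e : (robinD x + logIntegral 2 + LiThetaRH.posPart x -
      ((θ x - x) / Real.log x - (logIntegral (θ x) - logIntegral x))) * Real.log x ^ 2 / Real.sqrt x =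
      robinD x * r + logIntegral 2 * r + LiThetaRH.posPart x * r -
        ((θ x - x) / Real.log x - (logIntegral (θ x) - logIntegral x)) * r := by
    rw [hr']; ring
  rw [e]
  linarith


/-! ### §9. Explicit constants at `x₀ = 2` -/

/-- `ψ(2) = log 2`. [folklore] -/
private theorem psi_two : ψ 2 = Real.log 2 := by
  rw [Chebyshev.psi, show ⌊(2 : ℝ)⌋₊ = 2 by norm_num]
  rw [show Finset.Ioc 0 2 = {1, 2} by decide, Finset.sum_insert (by decide), Finset.sum_singleton]
  rw [ArithmeticFunction.vonMangoldt_apply_one, ArithmeticFunction.vonMangoldt_apply_prime Nat.prime_two]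
  push_cast
  ring

/-- `ψ₁(2) = 0`. [folklore] -/
private theorem psiOne_two : psiOne 2 = 0 := by
  rw [psiOne, show ⌊(2 : ℝ)⌋₊ = 2 by norm_num]
  rw [show Finset.Ioc 0 2 = {1, 2} by decide, Finset.sum_insert (by decide), Finset.sum_singleton]
  rw [ArithmeticFunction.vonMangoldt_apply_one]
  push_cast
  ring

/-- `Π(2) − Li(2) = 1`. [folklore] -/
private theorem piSubLi_two : PiLi.piSubLi 2 = 1 := by
  rw [PiLi.piSubLi, max_self, offsetLogIntegral_two, sub_zero, show ⌊(2 : ℝ)⌋₊ = 2 by norm_num]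
  rw [show Finset.Ioc 0 2 = {1, 2} by decide, Finset.sum_insert (by decide), Finset.sum_singleton]
  rw [ArithmeticFunction.vonMangoldt_apply_one, ArithmeticFunction.vonMangoldt_apply_prime Nat.prime_two]
  push_cast
  rw [zero_div, zero_add, div_self (Real.log_pos one_lt_two).ne']

/-- `F(2) = −2/log 2 − 1/log² 2`. [folklore] -/
private theorem robinF_two : robinF 2 = -2 / Real.log 2 - 1 / Real.log 2 ^ 2 := by
  have hl : Real.log 2 ≠ 0 := (Real.log_pos one_lt_two).ne'
  rw [robinF, robinD, psi_two, piSubLi_two, psiOneErr, psiOne_two, wt]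
  field_simp
  ring

/-- `|F(2)| ≤ 5`. [folklore] -/
private theorem abs_robinF_two_le : |robinF 2| ≤ 5 := by
  have h1 := Real.log_two_gt_d9
  have h2 := Real.log_two_lt_d9
  rw [robinF_two, abs_le]
  constructor
  · have ha : 2 / Real.log 2 ≤ 2 / 0.6931471803 := div_le_div_of_nonneg_left (by norm_num) (by norm_num) h1.le
    have hb : 1 / Real.log 2 ^ 2 ≤ 1 / 0.6931471803 ^ 2 :=
      div_le_div_of_nonneg_left (by norm_num) (by norm_num) (by nlinarith)
    have : (2 : ℝ) / 0.6931471803 + 1 / 0.6931471803 ^ 2 ≤ 5 := by norm_num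
    rw [neg_div]
    linarith
  · have : 0 < 2 / Real.log 2 := by positivity
    have : 0 < 1 / Real.log 2 ^ 2 := by positivity
    rw [neg_div]
    linarith

/-- `log 2π < 2`. [folklore] -/
private theorem log_two_pi_lt_two : Real.log (2 * π) < 2 := by
  rw [Real.log_lt_iff_lt_exp (by positivity)]
  have h1 := Real.pi_lt_d2
  have h2 : (6.3 : ℝ) < Real.exp 2 := by
    have := Real.add_one_le_exp (1 : ℝ)
    have h3 : Real.exp 2 = Real.exp 1 * Real.exp 1 := by rw [← Real.exp_add]; norm_num
    rw [h3]
    nlinarith [Real.exp_one_gt_d9]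
  linarith

/-- Under RH, `|Re E(2)| ≤ 3` (`Re E(2) = −2 + Re Z(2) + 2 log 2π`, `|Z(2)| ≤ λ 2^{3/2}`). [folklore] -/
private theorem abs_re_psiOneRemainder_two_le (hRH : RiemannHypothesis) : |(psiOneRemainder 2).re| ≤ 3 := by
  have h := psiOneErr_eq_re (by norm_num : (1 : ℝ) ≤ 2)
  have hR : psiOneErr 2 = -2 := by rw [psiOneErr, psiOne_two]; norm_num
  have hZ : |(Zsum 2).re| ≤ 0.2 := by
    have h1 := norm_psiOne_zeroSum_le_of_RH hRH (by norm_num : (1 : ℝ) ≤ 2)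
    have h2 := Complex.abs_re_le_norm (Zsum 2)
    have hβ := nicolasBeta_lt'
    have h3 : (2 : ℝ) ^ (3 / 2 : ℝ) ≤ 3 := by
      have : (2 : ℝ) ^ (3 / 2 : ℝ) = Real.sqrt 8 := by
        rw [show (8 : ℝ) = 2 ^ (3 : ℝ) by norm_num, Real.sqrt_eq_rpow, ← Real.rpow_mul (by norm_num)]
        norm_num
      rw [this, Real.sqrt_le_left (by norm_num)]
      norm_num
    have h4 : nicolasBeta * (2 : ℝ) ^ (3 / 2 : ℝ) ≤ 0.0474 * 3 := by
      have hβ0 : 0 ≤ nicolasBeta := (hasSum_zeroOrder_div_norm_sq_of_RH hRH).nonneg fun ρ ↦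
        div_nonneg (zeroOrder_nonneg' ρ) (sq_nonneg _)
      exact mul_le_mul hβ.le h3 (by positivity) (by norm_num)
    have : ‖Zsum 2‖ ≤ nicolasBeta * (2 : ℝ) ^ (3 / 2 : ℝ) := h1
    linarith [h2]
  have hl := log_two_pi_lt_two
  have hl0 : 0 < Real.log (2 * π) := Real.log_pos (by linarith [Real.pi_gt_three])
  rw [hR] at h
  rw [abs_le] at hZ ⊢
  constructor <;> nlinarith [hZ.1, hZ.2]

/-- Under RH, `λ₃ ≤ 2λ`. [folklore] -/
private theorem lam3_le (hRH : RiemannHypothesis) : lam3 ≤ 2 * nicolasBeta := by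
  have hS := hasSum_zeroOrder_div_norm_sq_of_RH hRH
  have h3 := (summable_lam3 hRH).hasSum
  refine hasSum_le (fun ρ ↦ ?_) h3 (hS.mul_left 2)
  have hn : 1 / 2 ≤ ‖(ρ : ℂ)‖ := half_le_norm hRH ρ
  have hn0 : 0 < ‖(ρ : ℂ)‖ := by linarith
  have hm := zeroOrder_nonneg' ρ
  rw [div_le_iff₀ (by positivity)]
  calc (riemannZetaZeroOrder (ρ : ℂ) : ℝ) = (riemannZetaZeroOrder (ρ : ℂ) : ℝ) * 1 := (mul_one _).symm
    _ ≤ (riemannZetaZeroOrder (ρ : ℂ) : ℝ) * (2 * ‖(ρ : ℂ)‖) := mul_le_mul_of_nonneg_left (by linarith) hm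
    _ = 2 * ((riemannZetaZeroOrder (ρ : ℂ) : ℝ) / ‖(ρ : ℂ)‖ ^ 2) * ‖(ρ : ℂ)‖ ^ 3 := by field_simp

/-- Under RH, `dConst 2 ≤ 20`. [folklore] -/
private theorem dConst_two_le (hRH : RiemannHypothesis) : dConst 2 ≤ 20 := by
  have h1 := Real.log_two_gt_d9
  have h2 := Real.log_two_lt_d9
  have hF := abs_robinF_two_le
  have hE := abs_re_psiOneRemainder_two_le hRH
  have hβ := nicolasBeta_lt'
  have hl3 := lam3_le hRH
  have hl30 := lam3_nonneg
  have hl2π := log_two_pi_lt_two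
  have hl2π0 : 0 < Real.log (2 * π) := Real.log_pos (by linarith [Real.pi_gt_three])
  have hs2 : Real.sqrt 2 ≤ 1.4143 := by
    rw [Real.sqrt_le_left (by norm_num)]; norm_num
  -- `u(2) ≤ 8.1`, `w(2) ≤ 1.05`, `1/log 2 + 1/log² 2 ≤ 3.53`
  have hq2 : (0.6931471803 : ℝ) ^ 2 ≤ Real.log 2 ^ 2 := pow_le_pow_left₀ (by norm_num) h1.le 2
  have hq3 : (0.6931471803 : ℝ) ^ 3 ≤ Real.log 2 ^ 3 := pow_le_pow_left₀ (by norm_num) h1.le 3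
  have hu : uw 2 ≤ 8.1 := by
    rw [uw, div_le_iff₀ (by positivity)]
    norm_num at hq3 ⊢
    linarith
  have hw : wt 2 ≤ 1.05 := by
    rw [wt, inv_le_comm₀ (by positivity) (by norm_num)]
    norm_num at hq2 ⊢
    linarith
  have hw0 : 0 ≤ wt 2 := by rw [wt]; positivity
  have hv : 1 / Real.log 2 + 1 / Real.log 2 ^ 2 ≤ 3.53 := by
    have ha : 1 / Real.log 2 ≤ 1 / 0.6931471803 := div_le_div_of_nonneg_left (by norm_num) (by norm_num) h1.le
    have hb : 1 / Real.log 2 ^ 2 ≤ 1 / 0.6931471803 ^ 2 :=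
      div_le_div_of_nonneg_left (by norm_num) (by norm_num) (by nlinarith)
    have : (1 : ℝ) / 0.6931471803 + 1 / 0.6931471803 ^ 2 ≤ 3.53 := by norm_num
    linarith
  have hx2 : (2 : ℝ) / (2 * (2 ^ 2 - 1)) = 1 / 3 := by norm_num
  unfold dConst
  rw [hx2]
  have t1 : lam3 * (Real.sqrt 2 * uw 2) ≤ 0.0948 * (1.4143 * 8.1) := by
    have := uw_nonneg one_lt_two
    exact mul_le_mul (by linarith) (mul_le_mul hs2 hu this (by norm_num)) (by positivity) (by norm_num)
  have t2 : Real.log (2 * π) * (1 / Real.log 2 + 1 / Real.log 2 ^ 2) ≤ 2 * 3.53 :=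
    mul_le_mul hl2π.le hv (by positivity) (by norm_num)
  have t3 : (|(psiOneRemainder 2).re| + 1 / 3) * wt 2 ≤ (3 + 1 / 3) * 1.05 :=
    mul_le_mul (by linarith) hw hw0 (by norm_num)
  norm_num at t1 t2 t3 ⊢
  linarith

/-- `∫_2^{e¹²} dt/(√t log³ t) ≤ 2430` (`≤ (1/log³ 2) ∫_2^{e¹²} t^{−1/2} dt = (2e⁶ − 2√2)/log³ 2`). [folklore] -/
private theorem intK0_le :
    ∫ t in (2 : ℝ)..max 2 (Real.exp 12), 1 / (Real.sqrt t * Real.log t ^ 3) ≤ 2430 := by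
  have he2 : (2 : ℝ) ≤ Real.exp 12 := by
    have := Real.add_one_le_exp (12 : ℝ); linarith
  rw [max_eq_right he2]
  have h1 := Real.log_two_gt_d9
  have hmem : ∀ t ∈ uIcc (2 : ℝ) (Real.exp 12), 2 ≤ t := fun t ht ↦ by
    rw [uIcc_of_le he2] at ht; exact ht.1
  -- the primitive `2√t` of `1/√t`
  have hderiv : ∀ t ∈ uIcc (2 : ℝ) (Real.exp 12), HasDerivAt (fun s : ℝ ↦ 2 * Real.sqrt s) (1 / Real.sqrt t) t := by
    intro t ht
    have ht0 : 0 < t := by linarith [hmem t ht]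
    have h := (Real.hasDerivAt_sqrt ht0.ne').const_mul 2
    refine h.congr_deriv ?_
    field_simp
  have hc : ContinuousOn (fun t : ℝ ↦ 1 / Real.sqrt t) (uIcc (2 : ℝ) (Real.exp 12)) := by
    refine continuousOn_const.div Real.continuous_sqrt.continuousOn fun t ht ↦ ?_
    exact (Real.sqrt_pos.2 (by linarith [hmem t ht])).ne'
  have hFTC := intervalIntegral.integral_eq_sub_of_hasDerivAt hderiv hc.intervalIntegrable
  have hsq : Real.sqrt (Real.exp 12) = Real.exp 6 := by
    rw [show (12 : ℝ) = 6 + 6 by norm_num, Real.exp_add, Real.sqrt_mul_self (Real.exp_pos 6).le]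
  have he6 : Real.exp 6 ≤ 403.43 := by
    have h := Real.exp_one_lt_d9
    have : Real.exp 6 = Real.exp 1 ^ 6 := by rw [← Real.exp_nat_mul]; norm_num
    rw [this]
    have h0 : 0 ≤ Real.exp 1 := (Real.exp_pos 1).le
    calc Real.exp 1 ^ 6 ≤ 2.7182818286 ^ 6 := pow_le_pow_left₀ h0 h.le 6
      _ ≤ 403.43 := by norm_num
  have hcl : ContinuousOn Real.log (uIcc (2 : ℝ) (Real.exp 12)) :=
    Real.continuousOn_log.mono fun t ht ↦ by have := hmem t ht; simp; linarith
  have hc3 : ContinuousOn (fun t : ℝ ↦ 1 / (Real.sqrt t * Real.log t ^ 3)) (uIcc (2 : ℝ) (Real.exp 12)) := by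
    refine continuousOn_const.div (Real.continuous_sqrt.continuousOn.mul (hcl.pow 3)) fun t ht ↦ ?_
    have := hmem t ht
    exact mul_ne_zero (Real.sqrt_pos.2 (by linarith)).ne' (pow_ne_zero _ (Real.log_pos (by linarith)).ne')
  have hmono : ∫ t in (2 : ℝ)..Real.exp 12, 1 / (Real.sqrt t * Real.log t ^ 3) ≤
      ∫ t in (2 : ℝ)..Real.exp 12, (1 / Real.log 2 ^ 3) * (1 / Real.sqrt t) := by
    refine intervalIntegral.integral_mono_on he2 hc3.intervalIntegrable (hc.intervalIntegrable.const_mul _)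
      fun t ht ↦ ?_
    have ht2 : 2 ≤ t := ht.1
    have hs : 0 < Real.sqrt t := Real.sqrt_pos.2 (by linarith)
    have hlt : Real.log 2 ≤ Real.log t := Real.log_le_log two_pos ht2
    have hl0 : 0 < Real.log 2 := by linarith
    rw [one_div_mul_one_div]
    refine div_le_div_of_nonneg_left zero_le_one (by positivity) ?_
    rw [mul_comm]
    exact mul_le_mul_of_nonneg_left (pow_le_pow_left₀ hl0.le hlt 3) hs.le
  rw [intervalIntegral.integral_const_mul, hFTC, hsq] at hmono
  have hl3 : 1 / Real.log 2 ^ 3 ≤ 1 / 0.6931471803 ^ 3 :=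
    div_le_div_of_nonneg_left (by norm_num) (by norm_num) (pow_le_pow_left₀ (by norm_num) h1.le 3)
  have hpos : 0 ≤ 2 * Real.sqrt (Real.exp 12) := by positivity
  have hs2 : 0 ≤ Real.sqrt 2 := Real.sqrt_nonneg 2
  have hs2e : Real.sqrt 2 ≤ Real.exp 6 := hsq ▸ Real.sqrt_le_sqrt he2
  have : 1 / Real.log 2 ^ 3 * (2 * Real.exp 6 - 2 * Real.sqrt 2) ≤ 1 / 0.6931471803 ^ 3 * (2 * 403.43) := by
    refine mul_le_mul hl3 (by linarith) (by linarith) (by norm_num)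
  refine hmono.trans (this.trans ?_)
  norm_num

/-! ### §10. Explicit `D` under RH: `|D(x)| ≤ 0.0474 √x/log²x + 4.3 √x/log³x + 2500` (`x ≥ 2`) -/

/-- **Explicit `D` under RH**: `|D(x)| ≤ 0.0474 √x/log² x + 4.3 √x/log³ x + 2500` for `x ≥ 2`
(`λ < 0.0474`, `λ₃ ≤ 2λ`, `dConst 2 ≤ 20`, `∫_2^{e¹²} dt/(√t log³t) ≤ 2430`). [cite: Nicolas2017, Prop. 3.1 (3.2)] -/
theorem abs_robinD_le_explicit (hRH : RiemannHypothesis) {x : ℝ} (hx : 2 ≤ x) :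
    |robinD x| ≤ 0.0474 * (Real.sqrt x / Real.log x ^ 2) + 4.3 * (Real.sqrt x / Real.log x ^ 3) + 2500 := by
  have h := abs_robinD_le_sharp hRH le_rfl hx
  have hβ := nicolasBeta_lt'
  have hl3 := lam3_le hRH
  have hl30 := lam3_nonneg
  have hd := dConst_two_le hRH
  have hK := intK0_le
  have h1 := Real.log_two_gt_d9
  have hc : 2 + 6 / Real.log 2 ≤ 10.66 := by
    have : 6 / Real.log 2 ≤ 6 / 0.6931471803 := div_le_div_of_nonneg_left (by norm_num) (by norm_num) h1.le
    norm_num at this ⊢; linarith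
  have hc0 : 0 ≤ 2 + 6 / Real.log 2 := by positivity
  have hI := (integral_sqrt_mul_abs_uwDeriv_le one_lt_two hx).trans
    (mul_le_mul_of_nonneg_left (integral_inv_sqrt_log_cube_le one_lt_two hx) hc0)
  have hlx : 0 < Real.log x := Real.log_pos (by linarith)
  have hs : 0 ≤ Real.sqrt x / Real.log x ^ 3 := by positivity
  have hs2 : 0 ≤ Real.sqrt x / Real.log x ^ 2 := by positivity
  have hK0 : 0 ≤ ∫ t in (2 : ℝ)..max 2 (Real.exp 12), 1 / (Real.sqrt t * Real.log t ^ 3) := by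
    refine intervalIntegral.integral_nonneg (le_max_left _ _) fun t ht ↦ ?_
    have := Real.log_pos (by linarith [ht.1] : (1 : ℝ) < t); positivity
  set K₀ := ∫ t in (2 : ℝ)..max 2 (Real.exp 12), 1 / (Real.sqrt t * Real.log t ^ 3)
  set sx : ℝ := Real.sqrt x / Real.log x ^ 3 with hsx
  have e1 : 2 * Real.sqrt x / Real.log x ^ 3 = 2 * sx := by rw [hsx]; ring
  have e2 : 4 * Real.sqrt x / Real.log x ^ 3 = 4 * sx := by rw [hsx]; ring
  rw [e1] at h
  rw [e2] at hI
  have hI' : ∫ t in (2 : ℝ)..x, Real.sqrt t * |uwDeriv t| ≤ 10.66 * (2430 + 4 * sx) := by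
    refine hI.trans ?_
    exact mul_le_mul hc (by linarith) (by positivity) (by norm_num)
  have hmain : nicolasBeta * (Real.sqrt x / Real.log x ^ 2) ≤ 0.0474 * (Real.sqrt x / Real.log x ^ 2) :=
    mul_le_mul_of_nonneg_right hβ.le hs2
  have hl3b : lam3 ≤ 0.0948 := by linarith
  have hI0 : 0 ≤ ∫ t in (2 : ℝ)..x, Real.sqrt t * |uwDeriv t| :=
    intervalIntegral.integral_nonneg hx fun t _ ↦ by positivity
  have hsum : 2 * sx + ∫ t in (2 : ℝ)..x, Real.sqrt t * |uwDeriv t| ≤ 2 * sx + 10.66 * (2430 + 4 * sx) := by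
    linarith
  have hsum0 : 0 ≤ 2 * sx + ∫ t in (2 : ℝ)..x, Real.sqrt t * |uwDeriv t| := by positivity
  have hmid : lam3 * (2 * sx + ∫ t in (2 : ℝ)..x, Real.sqrt t * |uwDeriv t|) ≤
      0.0948 * (2 * sx + 10.66 * (2430 + 4 * sx)) := mul_le_mul hl3b hsum hsum0 (by norm_num)
  norm_num at hmid ⊢
  nlinarith [hmain, hmid, hd, hs]

/-! ### §11. Explicit positivity of `A` for `x ≥ e³⁶` under RH and Schoenfeld's bounds -/

/-- `u³ ≤ 8 e^{u/4}` and `u⁴ ≤ e^{u/2}` for `u ≥ 36` (`log u ≤ log 32 + u/32 − 1`). [folklore] -/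
private theorem pow_le_exp_aux {u : ℝ} (hu : 36 ≤ u) :
    u ^ 3 ≤ 8 * Real.exp (u / 4) ∧ u ^ 4 ≤ Real.exp (u / 2) := by
  have hu0 : 0 < u := by linarith
  have h2 := Real.log_two_lt_d9
  have hlog : Real.log u ≤ 5 * Real.log 2 + u / 32 - 1 := by
    have h := Real.log_le_sub_one_of_pos (by positivity : 0 < u / 32)
    rw [Real.log_div hu0.ne' (by norm_num), show (32 : ℝ) = 2 ^ 5 by norm_num, Real.log_pow] at h
    push_cast at h
    linarith
  constructor
  · have h3 : 3 * Real.log u ≤ 3 * Real.log 2 + u / 4 := by nlinarith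
    have : u ^ 3 = Real.exp (3 * Real.log u) := by
      rw [← Real.rpow_natCast, Real.rpow_def_of_pos hu0]; ring_nf
    rw [this, show (8 : ℝ) = 2 ^ 3 by norm_num, ← Real.rpow_natCast 2 3,
      Real.rpow_def_of_pos two_pos, ← Real.exp_add]
    exact Real.exp_le_exp.2 (by push_cast; linarith)
  · have h4 : 4 * Real.log u ≤ u / 2 := by nlinarith
    have : u ^ 4 = Real.exp (4 * Real.log u) := by
      rw [← Real.rpow_natCast, Real.rpow_def_of_pos hu0]; ring_nf
    rw [this]
    exact Real.exp_le_exp.2 h4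

/-- `e^{u/2}/u² ≥ 44000` for `u ≥ 36`. [folklore] -/
private theorem exp_div_sq_ge {u : ℝ} (hu : 36 ≤ u) : 44000 * u ^ 2 ≤ Real.exp (u / 2) := by
  have hu0 : 0 < u := by linarith
  have h2 := Real.log_two_lt_d9
  have hlog : Real.log u ≤ 5 * Real.log 2 + u / 32 - 1 := by
    have h := Real.log_le_sub_one_of_pos (by positivity : 0 < u / 32)
    rw [Real.log_div hu0.ne' (by norm_num), show (32 : ℝ) = 2 ^ 5 by norm_num, Real.log_pow] at h
    push_cast at h
    linarith
  -- `44000 u² ≤ exp(10.7 + 2 log u)` and `10.7 + 2 log u ≤ u/2`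
  have he : Real.exp 10.7 ≥ 44000 := by
    have h := Real.exp_one_gt_d9
    have h1 : Real.exp 10.7 = Real.exp 1 ^ 10 * Real.exp 0.7 := by
      rw [← Real.exp_nat_mul, ← Real.exp_add]; norm_num
    have h3 : (2.012 : ℝ) ≤ Real.exp 0.7 := by
      have := Real.sum_le_exp_of_nonneg (by norm_num : (0 : ℝ) ≤ 0.7) 5
      norm_num [Finset.sum_range_succ, Nat.factorial] at this ⊢
      linarith
    have h4 : (2.7182818283 : ℝ) ^ 10 ≤ Real.exp 1 ^ 10 := pow_le_pow_left₀ (by norm_num) h.le 10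
    rw [h1]
    nlinarith [h4, h3, pow_nonneg (Real.exp_pos 1).le 10]
  have hkey : 2 * Real.log u + 10.7 ≤ u / 2 := by nlinarith
  have : 44000 * u ^ 2 ≤ Real.exp 10.7 * u ^ 2 := by nlinarith [sq_nonneg u]
  refine this.trans ?_
  have e : Real.exp 10.7 * u ^ 2 = Real.exp (10.7 + 2 * Real.log u) := by
    rw [Real.exp_add, show u ^ 2 = Real.exp (2 * Real.log u) by
      rw [← Real.rpow_natCast, Real.rpow_def_of_pos hu0]; ring_nf]
  rw [e]
  exact Real.exp_le_exp.2 (by linarith)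

/-- **Explicit lower bound for `B`** under RH and Schoenfeld's bounds: for `y ≥ 2657`,
`B(y) ≥ (y − 2)/log² y + (li 2 − 2/log 2) − √y log y/(4π)`
(`π ≥ li − √y log y/(8π)`, `θ ≤ y + √y log² y/(8π)`, `li(y) − y/log y = Li₂(y) + li 2 − 2/log 2 ≥ (y−2)/log² y + …`).
[cite: Nicolas2017, Lemma 3.3 (3.8)] -/
theorem nicolasB_ge_of_schoenfeld (hRH : RiemannHypothesis) (hθ : Schoenfeld1976_theta)
    (hπ : schoenfeld_explicit) {y : ℝ} (hy : 2657 ≤ y) :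
    (y - 2) / Real.log y ^ 2 + (logIntegral 2 - 2 / Real.log 2) - Real.sqrt y * Real.log y / (4 * π) ≤
      nicolasB y := by
  have hy1 : 1 < y := by linarith
  have hy0 : 0 < y := by linarith
  have hl : 0 < Real.log y := Real.log_pos hy1
  have h1 := (abs_lt.1 (hπ hRH y hy)).1
  have h2 := (abs_le.1 (hθ hRH y (by linarith))).2
  -- `li y − y/log y = Li₂ y + li 2 − 2/log 2 ≥ (y−2)/log² y + li 2 − 2/log 2`
  have hli : (y - 2) / Real.log y ^ 2 + (logIntegral 2 - 2 / Real.log 2) ≤ logIntegral y - y / Real.log y := by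
    have e0 := logIntegral_eq_offsetLogIntegral_add_logIntegral_two hy1
    have e1 := offsetLogIntegralPow_integration_by_parts 1 hy1
    rw [← offsetLogIntegralPow_one] at e0
    simp only [Nat.cast_one, one_mul, pow_one] at e1
    have e2 := sub_mul_inv_log_pow_le_offsetLogIntegralPow 2 (by linarith : (2 : ℝ) ≤ y)
    rw [e0, e1]
    have : (y - 2) / Real.log y ^ 2 = (y - 2) * (Real.log y)⁻¹ ^ 2 := by rw [inv_pow, div_eq_mul_inv]
    rw [this]
    have : y / Real.log y = y * (Real.log y)⁻¹ := div_eq_mul_inv _ _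
    rw [this]
    have : 2 / Real.log 2 = 2 * (Real.log 2)⁻¹ := div_eq_mul_inv _ _
    rw [this]
    linarith
  -- `θ(y)/log y ≤ y/log y + √y log y/(8π)`
  have hθ' : θ y / Real.log y ≤ y / Real.log y + Real.sqrt y * Real.log y / (8 * π) := by
    have : θ y ≤ y + Real.sqrt y * Real.log y ^ 2 / (8 * π) := by linarith
    have h3 : θ y / Real.log y ≤ (y + Real.sqrt y * Real.log y ^ 2 / (8 * π)) / Real.log y :=
      div_le_div_of_nonneg_right this hl.le
    have e : (y + Real.sqrt y * Real.log y ^ 2 / (8 * π)) / Real.log y =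
        y / Real.log y + Real.sqrt y * Real.log y / (8 * π) := by
      field_simp
    rw [e] at h3
    exact h3
  rw [nicolasB]
  have e : Real.sqrt y * Real.log y / (4 * π) = Real.sqrt y * Real.log y / (8 * π) + Real.sqrt y * Real.log y / (8 * π) := by
    ring
  rw [e]
  linarith

/-- **Explicit positivity under RH and Schoenfeld's bounds**: `A(x) > 0` for every `x ≥ e³⁶`
(the margin at `e³⁶ ≈ 4.3·10¹⁵` is a factor `> 5`; Nicolas's sharper constants give `x ≥ 9·10⁶`,
Prop. 3.3, which we do not reproduce). [cite: Nicolas2017, Prop. 3.3 (3.18) and Cor. 3.1] -/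
theorem liThetaSubPi_pos_of_exp_le (hRH : RiemannHypothesis) (hθ : Schoenfeld1976_theta)
    (hπ : schoenfeld_explicit) {x : ℝ} (hx : Real.exp 36 ≤ x) : 0 < liThetaSubPi x := by
  -- notation and ranges
  set u : ℝ := Real.log x with hu
  have he36 : (0 : ℝ) < Real.exp 36 := Real.exp_pos 36
  have hx0 : 0 < x := he36.trans_le hx
  have hu36 : 36 ≤ u := by rw [hu, Real.le_log_iff_exp_le hx0]; exact hx
  have hxu : x = Real.exp u := by rw [hu, Real.exp_log hx0]
  have hsx : Real.sqrt x = Real.exp (u / 2) := by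
    rw [hxu, show Real.exp u = Real.exp (u / 2) * Real.exp (u / 2) by rw [← Real.exp_add]; ring_nf,
      Real.sqrt_mul_self (Real.exp_pos _).le]
  have hs4 : Real.sqrt (Real.sqrt x) = Real.exp (u / 4) := by
    rw [hsx, show Real.exp (u / 2) = Real.exp (u / 4) * Real.exp (u / 4) by rw [← Real.exp_add]; ring_nf,
      Real.sqrt_mul_self (Real.exp_pos _).le]
  have hE18 : (6.5e7 : ℝ) ≤ Real.exp (u / 2) := by
    have h := Real.exp_one_gt_d9
    have : Real.exp 18 ≤ Real.exp (u / 2) := Real.exp_le_exp.2 (by linarith)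
    refine le_trans ?_ this
    have e : Real.exp 18 = Real.exp 1 ^ 18 := by rw [← Real.exp_nat_mul]; norm_num
    rw [e]
    calc (6.5e7 : ℝ) ≤ 2.7182818283 ^ 18 := by norm_num
      _ ≤ Real.exp 1 ^ 18 := pow_le_pow_left₀ (by norm_num) h.le 18
  have hsqx : (6.5e7 : ℝ) ≤ Real.sqrt x := hsx ▸ hE18
  have hxbig : (6.5e7 : ℝ) ^ 2 ≤ x := by
    have := pow_le_pow_left₀ (by norm_num) hsqx 2
    rwa [Real.sq_sqrt hx0.le] at this
  norm_num at hxbig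
  have hx2 : (2 : ℝ) ≤ x := by linarith
  have hx4 : (4 : ℝ) ≤ x := by linarith
  have hx599 : (599 : ℝ) ≤ x := by linarith
  -- the decomposition
  rw [liThetaSubPi_eq_posPart hx2]
  -- `D`
  have hD := abs_robinD_le_explicit hRH hx2
  -- `gap ≤ 8K² u²`, `K = 1/(8π)`
  have hθK : ∀ y : ℝ, 599 ≤ y → |θ y - y| ≤ 1 / (8 * π) * Real.sqrt y * Real.log y ^ 2 := by
    intro y hy
    have := hθ hRH y hy
    rwa [show 1 / (8 * π) * Real.sqrt y * Real.log y ^ 2 = Real.sqrt y * Real.log y ^ 2 / (8 * π) by ring]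
  have hsmall : 2 * (1 / (8 * π)) * Real.sqrt x * Real.log x ^ 2 ≤ x := by
    have hpi := Real.pi_gt_three
    have h4 := (pow_le_exp_aux hu36).2
    have hE0 : 0 < Real.exp (u / 2) := Real.exp_pos _
    have hK : 2 * (1 / (8 * π)) ≤ 1 / 12 := by
      rw [mul_one_div, div_le_div_iff₀ (by positivity) (by norm_num)]; linarith
    have h1296 : (1296 : ℝ) ≤ u ^ 2 := by
      have := pow_le_pow_left₀ (by norm_num : (0 : ℝ) ≤ 36) hu36 2
      norm_num at this
      exact this
    have hu2 : u ^ 2 ≤ Real.exp (u / 2) := by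
      have h7 : u ^ 2 * 1296 ≤ u ^ 2 * u ^ 2 := mul_le_mul_of_nonneg_left h1296 (sq_nonneg u)
      have h8 : u ^ 2 * u ^ 2 = u ^ 4 := by ring
      nlinarith [h7, h8, h4, sq_nonneg u]
    have key : 2 * (1 / (8 * π)) * Real.exp (u / 2) * u ^ 2 ≤ Real.exp (u / 2) * Real.exp (u / 2) := by
      have hEu : 0 ≤ Real.exp (u / 2) * u ^ 2 := by positivity
      have h5 : 2 * (1 / (8 * π)) * (Real.exp (u / 2) * u ^ 2) ≤ 1 / 12 * (Real.exp (u / 2) * u ^ 2) :=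
        mul_le_mul_of_nonneg_right hK hEu
      have h6 : Real.exp (u / 2) * u ^ 2 ≤ Real.exp (u / 2) * Real.exp (u / 2) :=
        mul_le_mul_of_nonneg_left hu2 hE0.le
      have e : 2 * (1 / (8 * π)) * Real.exp (u / 2) * u ^ 2 = 2 * (1 / (8 * π)) * (Real.exp (u / 2) * u ^ 2) := by
        ring
      rw [e]
      linarith
    calc 2 * (1 / (8 * π)) * Real.sqrt x * Real.log x ^ 2
        = 2 * (1 / (8 * π)) * Real.exp (u / 2) * u ^ 2 := by rw [hsx, ← hu]
      _ ≤ Real.exp (u / 2) * Real.exp (u / 2) := key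
      _ = x := by rw [← hsx, Real.mul_self_sqrt hx0.le]
  have hgap := gap_le_of_theta hθK hx599 hx4 hsmall
  -- `P ≥ B(√x)/2` and the explicit `B`
  have hP := (posPart_bounds hx4).1
  have hy : (2657 : ℝ) ≤ Real.sqrt x := by linarith
  have hB := nicolasB_ge_of_schoenfeld hRH hθ hπ hy
  have hli2 : 0 < logIntegral 2 := logIntegral_two_pos_holds
  -- numerics in `u`
  have hlsx : Real.log (Real.sqrt x) = u / 2 := by rw [hsx, Real.log_exp]
  rw [hlsx] at hB
  rw [hs4] at hB
  rw [hsx, ← hu] at hD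
  rw [← hu] at hgap
  rw [hsx] at hB hP
  have h1 := Real.log_two_gt_d9
  have hl2 : 2 / Real.log 2 ≤ 2.886 := by
    have : 2 / Real.log 2 ≤ 2 / 0.6931471803 := div_le_div_of_nonneg_left (by norm_num) (by norm_num) h1.le
    norm_num at this ⊢; linarith
  have hpi := Real.pi_gt_three
  have hpi' := Real.pi_lt_d2
  obtain ⟨h3, h4⟩ := pow_le_exp_aux hu36
  have h5 := exp_div_sq_ge hu36
  set E2 : ℝ := Real.exp (u / 2) with hE2
  set E4 : ℝ := Real.exp (u / 4) with hE4
  have hE2sq : E2 = E4 * E4 := by rw [hE2, hE4, ← Real.exp_add]; ring_nf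
  have hE4pos : 0 < E4 := Real.exp_pos _
  have hE2pos : 0 < E2 := Real.exp_pos _
  have hu0 : 0 < u := by linarith
  -- collect: main term `(E2 − 2)/(2 (u/2)²) = 2(E2−2)/u²`
  have eB : (E2 - 2) / (u / 2) ^ 2 = 4 * (E2 - 2) / u ^ 2 := by
    field_simp; ring
  rw [eB] at hB
  -- bounds on the pieces, all against `M = E2/u²`
  set M : ℝ := E2 / u ^ 2 with hM
  have hMpos : 0 < M := by positivity
  have hM44 : 44000 ≤ M := by rw [hM, le_div_iff₀ (by positivity)]; linarith
  have hu2M : u ^ 2 ≤ M := by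
    rw [hM, le_div_iff₀ (by positivity)]
    calc u ^ 2 * u ^ 2 = u ^ 4 := by ring
      _ ≤ E2 := h4
  have hQ : E2 / u ^ 3 ≤ M / 36 := by
    have e : E2 / u ^ 3 = M / u := by rw [hM]; field_simp
    rw [e]
    exact div_le_div_of_nonneg_left hMpos.le (by norm_num) hu36
  have hgap' : (θ x - x) / u - (logIntegral (θ x) - logIntegral x) ≤ 0.0128 * M := by
    refine hgap.trans ?_
    have : 8 * (1 / (8 * π)) ^ 2 ≤ 0.0128 := by
      have hp := Real.pi_gt_d2
      have hp2 : (3.14 : ℝ) ^ 2 < π ^ 2 := pow_lt_pow_left₀ hp (by norm_num) (by norm_num)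
      have e : 8 * (1 / (8 * π)) ^ 2 = 1 / (8 * π ^ 2) := by field_simp
      rw [e, div_le_iff₀ (by positivity)]
      norm_num at hp2 ⊢
      linarith
    calc 8 * (1 / (8 * π)) ^ 2 * u ^ 2 ≤ 0.0128 * u ^ 2 := mul_le_mul_of_nonneg_right this (sq_nonneg u)
      _ ≤ 0.0128 * M := mul_le_mul_of_nonneg_left hu2M (by norm_num)
  -- `E4 · (u/2)/(4π) ≤ M/3`: `E4 u = E2 u/E4 ≤ 8 E2/u²` from `u³ ≤ 8 E4`
  have hE4u : E4 * u ≤ 8 * M := by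
    rw [hM, hE2sq, mul_div_assoc', le_div_iff₀ (by positivity)]
    calc E4 * u * u ^ 2 = E4 * u ^ 3 := by ring
      _ ≤ E4 * (8 * E4) := mul_le_mul_of_nonneg_left h3 hE4pos.le
      _ = 8 * (E4 * E4) := by ring
  have hBterm : E4 * (u / 2) / (4 * π) ≤ M / 3 := by
    calc E4 * (u / 2) / (4 * π) = E4 * u / (8 * π) := by ring
      _ ≤ 8 * M / (8 * π) := div_le_div_of_nonneg_right hE4u (by positivity)
      _ = M / π := by field_simp
      _ ≤ M / 3 := div_le_div_of_nonneg_left hMpos.le (by norm_num) hpi.le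
  have e4 : 4 * (E2 - 2) / u ^ 2 = 4 * M - 8 / u ^ 2 := by rw [hM]; field_simp; ring
  rw [e4] at hB
  have h1296 : (1296 : ℝ) ≤ u ^ 2 := by
    have := pow_le_pow_left₀ (by norm_num : (0 : ℝ) ≤ 36) hu36 2
    norm_num at this
    exact this
  have h8 : 8 / u ^ 2 ≤ 0.0062 := by
    rw [div_le_iff₀ (by positivity)]; linarith
  have hDlow := neg_abs_le (robinD x)
  linarith [hD, hP, hB, hgap', hBterm, hQ, hM44, hli2, hl2, h8, hDlow]

end LiThetaLimsup

open LiThetaLimsup in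
/-- **Nicolas 2017, Thm. 1.1 (1.8) from the Platt–Trudgian range**: under RH, `A(x) > 0` for every
`x ≥ 11` — below `1.39·10¹⁷` this is Prop. 3.6 (i) (RH-free, from the named fact
`PlattTrudgian2016_theta_lt`, the tree's `Nicolas2017_prop36_i`), above it the explicit estimate
`liThetaSubPi_pos_of_exp_le` (RH with Schoenfeld's explicit bounds, here the named facts
`Schoenfeld1976_theta`, `schoenfeld_explicit`). [cite: Nicolas2017, Thm. 1.1 (1.8); Prop. 3.6 (i), Cor. 3.1] -/
theorem Nicolas2017_thm1_1_pos_of (hθ : Schoenfeld1976_theta) (hπ : schoenfeld_explicit)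
    (hPT : PlattTrudgian2016_theta_lt) (hRH : RiemannHypothesis) {x : ℝ} (hx : 11 ≤ x) :
    0 < liThetaSubPi x := by
  rcases le_or_gt x (139 * 10 ^ 15) with h | h
  · exact Nicolas2017_prop36_i hPT hx h
  · refine liThetaSubPi_pos_of_exp_le hRH hθ hπ (le_of_lt (lt_trans ?_ h))
    -- `e³⁶ < 1.39·10¹⁷`: `e < 2.7182818286`, `2.7182818286³⁶ < 1.39·10¹⁷`
    have he := Real.exp_one_lt_d9
    have e : Real.exp 36 = Real.exp 1 ^ 36 := by rw [← Real.exp_nat_mul]; norm_num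
    rw [e]
    calc Real.exp 1 ^ 36 < 2.7182818286 ^ 36 := pow_lt_pow_left₀ he (Real.exp_pos 1).le (by norm_num)
      _ < 139 * 10 ^ 15 := by norm_num

/-- **`RH ⟺ A(x) > 0` for every `x ≥ 11`** (Nicolas 2017, Cor. 1.1 for (1.8); Broughan vol. 3, Ch. 1),
PROVED as an equivalence over the RH-free computational range fact `PlattTrudgian2016_theta_lt`
(`θ(x) < x`, `x ≤ 1.39·10¹⁷`) and Schoenfeld's explicit RH bounds as named facts (standard axioms;
feed `Schoenfeld1976_theta_holds`, `schoenfeld_explicit_holds` for the form over `PlattTrudgian2016_theta_lt`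
alone, at the price of their certified-zeros computational closure).
[cite: Nicolas2017, Cor. 1.1 (for (1.8)); Broughan2023Further, Ch. 1] -/
theorem riemannHypothesis_iff_liThetaSubPi_pos_of_schoenfeld (hθ : Schoenfeld1976_theta)
    (hπ : schoenfeld_explicit) (hPT : PlattTrudgian2016_theta_lt) :
    RiemannHypothesis ↔ ∀ x : ℝ, 11 ≤ x → 0 < liThetaSubPi x :=
  ⟨fun hRH _ hx ↦ Nicolas2017_thm1_1_pos_of hθ hπ hPT hRH hx,
    fun h ↦ riemannHypothesis_of_eventually_liThetaSubPi_pos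
      ((eventually_ge_atTop 11).mono fun _ hx ↦ h _ hx)⟩

/-! ### Main statements -/

open LiThetaLimsup in
/-- **Nicolas 2017, Thm. 1.1 (1.6), PROVED under RH**: for every `ε > 0`, eventually
`A(x) log² x/√x ≤ 2 + λ + ε` (`A = liThetaSubPi`, `λ = nicolasBeta = ∑_ρ 1/|ρ|²`).
[cite: Nicolas2017, Thm. 1.1 (1.6)] -/
theorem Nicolas2017_thm1_1_limsup (hRH : RiemannHypothesis) :
    ∀ ε : ℝ, 0 < ε → ∀ᶠ x : ℝ in atTop,
      liThetaSubPi x * Real.log x ^ 2 / Real.sqrt x ≤ 2 + nicolasBeta + ε :=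
  fun _ hε ↦ limsup_le hRH hε

open LiThetaLimsup in
/-- **Nicolas 2017, Thm. 1.1 (1.7), PROVED under RH**: for every `ε > 0`, eventually
`A(x) log² x/√x ≥ 2 − λ − ε`. [cite: Nicolas2017, Thm. 1.1 (1.7)] -/
theorem Nicolas2017_thm1_1_liminf (hRH : RiemannHypothesis) :
    ∀ ε : ℝ, 0 < ε → ∀ᶠ x : ℝ in atTop,
      2 - nicolasBeta - ε ≤ liThetaSubPi x * Real.log x ^ 2 / Real.sqrt x :=
  fun _ hε ↦ le_liminf hRH hε

/-- **The named fact `Nicolas2017_thm1_1` follows from its three explicit-range clauses alone**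
((1.8) `A(x) > 0` for `x ≥ 11`, (1.9) for `x ≥ 37`, (1.10) for `x ≥ 2`): the asymptotic clauses
(1.6)–(1.7) are theorems of this file. [cite: Nicolas2017, Thm. 1.1] -/
theorem Nicolas2017_thm1_1_of_explicit
    (h : RiemannHypothesis →
      (∀ x : ℝ, 11 ≤ x → 0 < liThetaSubPi x) ∧
      (∀ x : ℝ, 37 ≤ x → (2 - nicolasBeta) * Real.sqrt x / Real.log x ^ 2 ≤ liThetaSubPi x) ∧
      (∀ x : ℝ, 2 ≤ x → liThetaSubPi x ≤ nicolasM * Real.sqrt x / Real.log x ^ 2)) :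
    Nicolas2017_thm1_1 := fun hRH ↦
  ⟨Nicolas2017_thm1_1_limsup hRH, Nicolas2017_thm1_1_liminf hRH, (h hRH).1, (h hRH).2.1, (h hRH).2.2⟩

/-- **`RH ⟺ lim sup A(x) log² x/√x ≤ 2 + λ`** (Nicolas 2017, Cor. 1.1 for (1.6)), PROVED as an
equivalence: `⟹` is `Nicolas2017_thm1_1_limsup`, `⟸` is Robin's `Ω₊(x^b)`, `b > 1/2`
(`Robin1984Toulouse_lemma2_holds`). [cite: Nicolas2017, Cor. 1.1; Robin1984Toulouse, Lemma 2] -/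
theorem riemannHypothesis_iff_liThetaSubPi_limsup_le :
    RiemannHypothesis ↔ ∀ ε : ℝ, 0 < ε → ∀ᶠ x : ℝ in atTop,
      liThetaSubPi x * Real.log x ^ 2 / Real.sqrt x ≤ 2 + nicolasBeta + ε := by
  refine ⟨Nicolas2017_thm1_1_limsup, fun h ↦ ?_⟩
  by_contra hRH
  obtain ⟨b, hb, c, hc, hpos, -⟩ := Robin1984Toulouse_lemma2_holds hRH
  have h1 := h 1 one_pos
  set M : ℝ := |2 + nicolasBeta + 1| + 1 with hM
  have hM0 : 0 < M := by positivity
  -- eventually `M √x ≤ c x^b`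
  have hpow : Tendsto (fun x : ℝ ↦ x ^ (b - 1 / 2)) atTop atTop := tendsto_rpow_atTop (by linarith)
  have hev : ∀ᶠ x : ℝ in atTop, M * Real.sqrt x < c * x ^ b := by
    filter_upwards [(tendsto_atTop.1 hpow) (M / c + 1), eventually_gt_atTop 1] with x hx hx1
    have hx0 : 0 < x := by linarith
    have hs : 0 < Real.sqrt x := Real.sqrt_pos.2 hx0
    have e : x ^ b = x ^ (b - 1 / 2) * Real.sqrt x := by
      rw [Real.sqrt_eq_rpow, ← Real.rpow_add hx0]; norm_num
    rw [e]
    have : M / c < x ^ (b - 1 / 2) := by linarith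
    have h2 : M < c * x ^ (b - 1 / 2) := by rwa [div_lt_iff₀' hc] at this
    nlinarith
  obtain ⟨x, hcx, ⟨hA, hMx⟩, hx1⟩ := (hpos.and_eventually ((h1.and hev).and (eventually_gt_atTop 3))).exists
  have hx0 : 0 < x := by linarith
  have hs : 0 < Real.sqrt x := Real.sqrt_pos.2 hx0
  have hl1 : 1 ≤ Real.log x := by
    rw [Real.le_log_iff_exp_le hx0]; exact Real.exp_one_lt_d9.le.trans (by linarith)
  have hl2 : 1 ≤ Real.log x ^ 2 := one_le_pow₀ hl1
  -- `A(x) ≤ (2+λ+1) √x/log² x ≤ M √x`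
  have hA' : liThetaSubPi x ≤ (2 + nicolasBeta + 1) * (Real.sqrt x / Real.log x ^ 2) := by
    have := (div_le_iff₀ hs).1 hA
    have hl0 : 0 < Real.log x ^ 2 := by positivity
    rw [mul_div_assoc', le_div_iff₀ hl0]
    exact this
  have hq : Real.sqrt x / Real.log x ^ 2 ≤ Real.sqrt x := div_le_self hs.le hl2
  have hA'' : liThetaSubPi x ≤ M * Real.sqrt x := by
    calc liThetaSubPi x ≤ (2 + nicolasBeta + 1) * (Real.sqrt x / Real.log x ^ 2) := hA'
      _ ≤ |2 + nicolasBeta + 1| * (Real.sqrt x / Real.log x ^ 2) :=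
          mul_le_mul_of_nonneg_right (le_abs_self _) (by positivity)
      _ ≤ |2 + nicolasBeta + 1| * Real.sqrt x := mul_le_mul_of_nonneg_left hq (abs_nonneg _)
      _ ≤ M * Real.sqrt x := by rw [hM]; nlinarith
  linarith

/-- **`RH ⟺ lim inf A(x) log² x/√x ≥ 2 − λ`** (Nicolas 2017, Cor. 1.1 for (1.7)), PROVED as an
equivalence (`⟸`: Robin's `Ω₋(x^b)` makes `A` negative at arbitrarily large `x`).
[cite: Nicolas2017, Cor. 1.1; Robin1984Toulouse, Lemma 2] -/
theorem riemannHypothesis_iff_liThetaSubPi_liminf_ge :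
    RiemannHypothesis ↔ ∀ ε : ℝ, 0 < ε → ∀ᶠ x : ℝ in atTop,
      2 - nicolasBeta - ε ≤ liThetaSubPi x * Real.log x ^ 2 / Real.sqrt x := by
  refine ⟨Nicolas2017_thm1_1_liminf, fun h ↦ ?_⟩
  by_contra hRH
  obtain ⟨b, -, c, hc, -, hneg⟩ := Robin1984Toulouse_lemma2_holds hRH
  have hβ := nicolasBeta_lt
  have h1 := h (1 / 2) one_half_pos
  obtain ⟨x, hcx, hA, hx1⟩ := (hneg.and_eventually (h1.and (eventually_gt_atTop 1))).exists
  have hx0 : 0 < x := by linarith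
  have hs : 0 < Real.sqrt x := Real.sqrt_pos.2 hx0
  have hl : 0 < Real.log x := Real.log_pos hx1
  have hxb : 0 < x ^ b := Real.rpow_pos_of_pos hx0 b
  have hAneg : liThetaSubPi x < 0 := by nlinarith
  have hApos : 0 < liThetaSubPi x := by
    have h2 : 0 < liThetaSubPi x * Real.log x ^ 2 / Real.sqrt x := by
      have : (0 : ℝ) < 2 - nicolasBeta - 1 / 2 := by norm_num at hβ ⊢; linarith
      linarith
    have h3 := mul_pos h2 hs
    rw [div_mul_cancel₀ _ hs.ne'] at h3
    exact pos_of_mul_pos_left h3 (by positivity)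
  linarith


end Literature.NumberTheory.LFunctions

end
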